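import Literature.MathematicalPhysics.QuantumFieldTheory.Balaban1983to89.B9Ineq346SecondOrderTorusCutoff
import Literature.MathematicalPhysics.QuantumFieldTheory.Balaban1983to89.B6Prop22HolderMultiLevelTorus

/-!
# `Balaban1983to89.B9Ineq344DualComparisonTorus` — [B9] (3.44)–(3.45) AT U = 1 FOR THE GENUINE k-LEVEL OPERATOR
# `G′ = Δ′_a⁻¹` ON THE TORUS: THE DUAL LOCAL COMPARISON — the second-order quantity `(∂_μG′∂_νᵀλ)(x)` EQUALS the
# second-order quantity of ANY local comparison operator near the source block plus a pairing of a first-order quantity of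
# the comparison operator with a commutator applied to the COLUMN `G′∂_μᵀδ_x`, and that pairing is bounded by the row-block
# `ℓ¹` norms of `∂_μG′` (lit-balaban-p21's PROVED members of (2.67)) times LOCAL second-order data of the comparison operator

T. Bałaban, *Propagators for lattice gauge theories in a background field*, Commun. Math. Phys. **99** (1985) 389–434
[`Balaban1985BackgroundPropagators`, "B9"]; [4] = T. Bałaban, *Propagators and renormalization transformations for lattice
gauge theories. II*, Commun. Math. Phys. **96** (1984) 223–250 [`Balaban1984PropagatorsII`]; [B5] = T. Bałaban, *Propagators and
renormalization transformations for lattice gauge theories. I*, Commun. Math. Phys. **95** (1984) 17–40 [`Balaban1984PropagatorsI`].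

statement-level skeleton of published theorems with citation tags; proofs where landed; nothing here is a claim about the
Yang–Mills mass gap

THE PRINTED LOCI (verbatim).  [B9] Thm 3.1 (3.44)–(3.45) p. 398 (the input-Hölder members `|∇_UG′∇*_Uλ|`, `‖ζ∇_UG′∇*_Uλ‖_β`);
Cor. 3.5 p. 407: *"For operators with the external gauge field configuration U = 1, these theorems are proved in [4]"*; [4]
Prop. 2.2 (2.67) p. 234 prints the first-order members only (cell GAP G-B9-03a), Prop. 2.6 (2.138)–(2.139) p. 247 the
second-order members for G *"Reasoning in the same way as in the proof of Proposition 2.2"*; [B5] Prop. 1.2 (1.110),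
(1.112)–(1.113) p. 36 (the one-level torus operator; second order via (1.135)–(1.137) pp. 39–40, in the tree as
`B5SecondOrderGpTorus`), and the printed route for second-order members of a random-walk sum, (1.123)–(1.131) pp. 37–38
(first factor `∇hGh`, commutators `K(h)` of first order, last factor `K(h)Gh∇*J`).

THE POINT.  After this seat's FILE 15 (`B9Ineq344GpAtLetters`) row 11 of the N06 knit at def-Y's instance is ⇐ two flat
inequalities about p21's `gmlT`: the sup and the one-block-pair Hölder quotient of `Ψ := ∂_μG′∂_νᵀλ` on `B(s)` for `λ` in
`B(s′)`.  THIS FILE proves, on the genuine k-level torus and WITHOUT a random-walk expansion, that both are controlled by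
(a) p21's PROVED first-order∕Hölder majorants of `∂_μG′` (members 1 and 4 of (2.67): `prop22_second_multiLevelTorus`,
`prop22_fourth_multiLevelTorus_unif`) and (b) [B5]-Prop-1.2-type LOCAL data of an ARBITRARY comparison pair `(A^c, G^c)` with
`G^cA^c = 1`, `G^c` symmetric and `A^c = −Δ + V^c` on functions supported in a cut-off region around `B(s′)`:

* §1 (any finite carrier; pure matrix algebra) the DUAL REPRESENTATION `Ψ(x) = Σ_z λ(z)(∂_ν w_x)(z)`, `w_x := G′∂_μᵀδ_x`
  (`mulVec_PGQ_apply`, by the symmetry of `G′`), and ★ THE COMPARISON IDENTITY `dual_comparison_identity`: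
  for a cut-off `χ` with `χ ≡ 1` on the `∂_ν`-stencil of `supp λ` and `χ(x) = χ(x+e_μ) = c`,
  `Ψ(x) = c·(∂_μG^c∂_νᵀλ)(x) + ⟨G^c∂_νᵀλ, A^c(χw_x) − χ·∂_μᵀδ_x⟩` — EXACT, for every pair `G^cA^c = 1`;
* §2 (p21's torus) ★ THE COMMUTATOR PAIRING BOUND `pairing_commutator_le`: with `E_χ(v) := A^c(χv) − χ·Δ′_a v` (so that the
  pairing above is `⟨φ, E_χ(w_x)⟩`, `Δ′_a w_x = ∂_μᵀδ_x`), for EVERY `v`,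
  `|⟨φ, E_χ(v)⟩| ≤ [Φ₀(3(d+1)K₂ + κ_c + κ) + 2(d+1)K₁Φ₁]·Σ_{t∈𝒩}Σ_{y∈B(t)}|v(y)|`, where `|φ| ≤ Φ₀`, `|∂_κφ|, |∂_κᵀφ| ≤ Φ₁` on the
  blocks of `𝒩` (for `φ = G^c∂_νᵀλ` these are [B5] (1.110)₃ and (1.112) with p. 36's remark on the choice of derivatives),
  `|∂χ| ≤ K₁`, `|∂∂χ| ≤ K₂`, `V^c` an `ℓ¹`-`κ_c`-contraction on `supp χ`, `κ ≥ a_jL^{−2j}` on `𝒩` ⊇ the blocks met by the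
  `1`-neighbourhood of `supp χ` — the discrete product rule `perLapT_mulVec_mul` (Core), summation by parts of the bond term
  `B(χ,·)` (`sum_bond_forward_eq`, `sum_bond_backward_eq`), the block structure of `Δ′_a − (−Δ)` (`mlOpT_mulVec_eq`,
  `levC_mul_card_le`);
* §3 ROW-BLOCK `ℓ¹` NORMS FROM MAJORANTS (lit-balaban's `row_abs_sum_le`: a `HasMajorant` bound IS a bound of
  `Σ_{z∈B(t)}|T(x,z)|`), `colW_gmlT_apply` (`w_x(z) = (∂_μG′)(x,z)`), hence ★ `rowBlock_l1_dGp` (`Σ_{z∈B(t)}|w_x(z)| ≤ C L^{j(x)}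
  e^{−½δ₀d_T}`, p21 member 1) and ★ `rowBlock_l1_dGp_holder` (`Σ_{z∈B(t)}|w_{x′}(z) − w_x(z)| ≤ C|x′−x|_T^α L^{j(1−α)}e^{−½δ₀d_T}`
  for `x, x′` in one block, p21 member 4);
* §4 ★★ THE ASSEMBLED REDUCTIONS `abs_dGpd_le_dual` ((3.44)-shape: `|Ψ(x)| ≤ |c|·|(∂_μG^c∂_νᵀλ)(x)| + Θ·Σ_{t∈𝒩}‖w_x‖_{ℓ¹(B(t))}`)
  and `abs_dGpd_sub_le_dual` ((3.45)-shape, same `χ` for the pair `x, x′`: `|Ψ(x′) − Ψ(x)| ≤ |c|·|Δ_{x,x′}∂_μG^c∂_νᵀλ| +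
  Θ·Σ_{t∈𝒩}‖w_{x′} − w_x‖_{ℓ¹(B(t))}`), and their composition with §3: ★★ `abs_dGpd_le_dual_majorant`,
  ★★ `abs_dGpd_sub_le_dual_majorant` (p21's constants, every admissible torus family, every comparison datum).

HONEST SCOPE.  A kernel-checked REDUCTION: (3.44)∕(3.45) for the multilevel torus operator ⇐ the LOCAL second-order clauses
of a comparison operator near the source block (the displayed `Φ₀, Φ₁` and the near-case term) + p21's proved members.  The
comparison datum is NOT constructed here (intended: p21's charted cube operator `G′(□)` ∕ the one-level operator of
`B5SecondOrderGpTorus`, whose (1.110)₃∕(1.112)∕(1.113) give `Φ₀ = O(L^{j′})|λ|`, `Φ₁ = O(1)(‖λ‖_ε + |λ|)`); the level-gap factor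
`L^{j−j′}` and the count of `𝒩` are left displayed ((2.60)∕(2.61) bookkeeping for the instance file).  Route DIVERGENCE
(declared): print transports second-order members through the random-walk expansion ((1.123)–(1.131)); this file replaces
the transport by duality + one commutator, using the walk's OUTPUT (p21's majorants) instead.  Nothing of [B9]∕[4]∕[B5] is
asserted; count-neutral; N06 NOT discharged; one finite lattice programme — nothing continuum, nothing about the mass gap.
Cell `pub-ymgap` (HUMAN RULING D-0062), Track A node N06 [B9], N06-ASSIGNMENT v1 row 11 (bundle F3), seat `pub-ymgap-dag-n06-h`
(g4), 2026-08-27.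
-/

noncomputable section

namespace Literature.MathematicalPhysics.QuantumFieldTheory.Balaban1983to89.B9Ineq344DualComparisonTorus

open Finset Matrix
open B4Reflection242 (boxDom)
open B4TorusKernel.MultiPeriod (torusSupNorm)
open B6MultiLevelBoxOperator (N0 levC)
open B6MultiLevelTorusOperator
open B6Prop22DerivMultiLevelTorus (dT dT_mulVec prop22_second_multiLevelTorus)
open B6Prop22HolderMultiLevelTorus (prop22_fourth_multiLevelTorus_unif)
open B6Geom246MultiLevelBox (bset blkOf)
open B6Geom246MultiLevelTorus (geomT)
open B6Ineq243TwoLevelBox (aNext)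
open B6RandomWalk (HasMajorant BlockSupp)
open B9Ineq346SecondOrderTorusCore (dT_transpose_mulVec perLapT_mulVec_mul mlOpT_mulVec_eq lev_eq_scale levC_mul_card_le
  sum_weight_le)

variable {d : ℕ}

/-! ## §1 Pure matrix algebra on a finite carrier: the dual representation and the comparison identity -/

section Generic

variable {X : Type} [Fintype X] [DecidableEq X]

/-- the COLUMN of `G·Pᵀ` at `x`: `w_x := (G Pᵀ)δ_x` (for `P = ∂_μ`, `G = G′`: `w_x = G′∂_μᵀδ_x`).
[cite: Balaban1984PropagatorsI, (1.123) p.37 («a representation of G adjoint to (1.123), with the operators K(h) acting on the right»), dictionary] -/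
def colW (Gm P : Matrix X X ℝ) (x : X) : X → ℝ := (Gm * Pᵀ) *ᵥ Pi.single x 1

/-- `w_x(z) = (G Pᵀ)(z, x)`. [cite: Balaban1984PropagatorsI, (1.123) p.37, dictionary] -/
theorem colW_apply (Gm P : Matrix X X ℝ) (x z : X) : colW Gm P x z = (Gm * Pᵀ) z x := by
  unfold colW
  rw [Matrix.mulVec_single_one]
  rfl

/-- for symmetric `G`: `w_x(z) = (P G)(x, z)` — the column of `G Pᵀ` at `x` IS the row of `P G` at `x`.
[cite: Balaban1984PropagatorsII, p.225 («G′ … a well defined, positive operator»), dictionary] -/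
theorem colW_apply_of_isSymm {Gm : Matrix X X ℝ} (hG : Gm.IsSymm) (P : Matrix X X ℝ) (x z : X) :
    colW Gm P x z = (P * Gm) x z := by
  rw [colW_apply, Matrix.mul_apply, Matrix.mul_apply]
  refine Finset.sum_congr rfl fun b _ => ?_
  rw [Matrix.transpose_apply, hG.apply b z, mul_comm]

/-- `A·w_x = Pᵀδ_x` when `A·G = 1` (`Δ′_a(G′∂_μᵀδ_x) = ∂_μᵀδ_x`). [cite: Balaban1984PropagatorsII, p.225 («G′ = Δ′_a^{−1}»), dictionary] -/
theorem mulVec_colW_of_mul_eq_one {A Gm : Matrix X X ℝ} (hAG : A * Gm = 1) (P : Matrix X X ℝ) (x : X) :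
    A *ᵥ colW Gm P x = Pᵀ *ᵥ Pi.single x 1 := by
  unfold colW
  rw [Matrix.mulVec_mulVec, ← Matrix.mul_assoc, hAG, Matrix.one_mul]

/-- **THE DUAL REPRESENTATION**: for symmetric `G`, `((P G Qᵀ)λ)(x) = Σ_z λ(z)·(Q w_x)(z)` — the second-order quantity at `x`
is the pairing of `λ` with `Q` applied to the column `w_x = G Pᵀδ_x`.
[cite: Balaban1984PropagatorsI, p.39 («we have to take a representation of G adjoint to (1.123)»), dictionary] -/
theorem mulVec_PGQ_apply {Gm : Matrix X X ℝ} (hG : Gm.IsSymm) (P Q : Matrix X X ℝ) (lam : X → ℝ) (x : X) :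
    ((P * Gm * Qᵀ) *ᵥ lam) x = ∑ z, lam z * (Q *ᵥ colW Gm P x) z := by
  simp only [Matrix.mulVec, dotProduct, colW_apply_of_isSymm hG]
  refine Finset.sum_congr rfl fun z _ => ?_
  rw [Matrix.mul_apply, mul_comm]
  congr 1
  refine Finset.sum_congr rfl fun b _ => ?_
  rw [Matrix.transpose_apply, mul_comm]

omit [DecidableEq X] in
/-- the pairing `Σ_z λ(z)(Q(G v))(z)` is `⟨(G Qᵀ)λ, v⟩` for symmetric `G` (moving `Q` and `G` onto `λ`).
[cite: Balaban1984PropagatorsI, p.39 (adjoint representation), dictionary] -/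
theorem sum_mul_mulVec_mulVec_eq_dot {Gc : Matrix X X ℝ} (hGc : Gc.IsSymm) (Q : Matrix X X ℝ) (lam v : X → ℝ) :
    ∑ z, lam z * (Q *ᵥ (Gc *ᵥ v)) z = ((Gc * Qᵀ) *ᵥ lam) ⬝ᵥ v := by
  have h1 : ∑ z, lam z * (Q *ᵥ (Gc *ᵥ v)) z = lam ⬝ᵥ ((Q * Gc) *ᵥ v) := by
    rw [Matrix.mulVec_mulVec]; rfl
  rw [h1, Matrix.dotProduct_mulVec, ← Matrix.mulVec_transpose, Matrix.transpose_mul, hGc.eq]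

/-- ★ **THE COMPARISON IDENTITY** (pure algebra, any finite carrier).  Let `G` (the operator) and `G^c` (the comparison) be
symmetric, `G^cA^c = 1`, `χ` a cut-off, `w_x = G Pᵀδ_x`.  If `Q w_x` and `Q(χw_x)` agree on `supp λ` (χ ≡ 1 on the `Q`-stencil of
`supp λ`) and `χ = c` on the support of `Pᵀδ_x` (the `P`-stencil of `x`), then
`((P G Qᵀ)λ)(x) = c·((P G^c Qᵀ)λ)(x) + ⟨(G^c Qᵀ)λ, A^c(χ w_x) − χ·Pᵀδ_x⟩`.
(For `P = ∂_μ`, `Q = ∂_ν`: `(∂_μG′∂_νᵀλ)(x) = c·(∂_μG^c∂_νᵀλ)(x) + ⟨G^c∂_νᵀλ, A^c(χw_x) − χ∂_μᵀδ_x⟩`.)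
[cite: Balaban1984PropagatorsI, (1.121)–(1.123) p.37 («Δh A = hΔ_aA − K(h)A», the commutator identity behind the walk), p.39; Balaban1985BackgroundPropagators, (3.44) p.398] -/
theorem dual_comparison_identity {Gm Gc Ac : Matrix X X ℝ} (hGm : Gm.IsSymm) (hGc : Gc.IsSymm) (hGcAc : Gc * Ac = 1)
    (P Q : Matrix X X ℝ) (lam χ : X → ℝ) (x : X) (c : ℝ)
    (hQ : ∀ z, lam z ≠ 0 → (Q *ᵥ colW Gm P x) z = (Q *ᵥ (χ * colW Gm P x)) z)
    (hP : ∀ a, (Pᵀ *ᵥ Pi.single x 1) a ≠ 0 → χ a = c) :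
    ((P * Gm * Qᵀ) *ᵥ lam) x = c * ((P * Gc * Qᵀ) *ᵥ lam) x
      + ((Gc * Qᵀ) *ᵥ lam) ⬝ᵥ (Ac *ᵥ (χ * colW Gm P x) - χ * (Pᵀ *ᵥ Pi.single x 1)) := by
  set w := colW Gm P x with hw
  set u : X → ℝ := χ * w with hu
  set E : X → ℝ := Ac *ᵥ u - χ * (Pᵀ *ᵥ Pi.single x 1) with hE
  -- (i) the dual representation with `χ` inserted
  have h1 : ((P * Gm * Qᵀ) *ᵥ lam) x = ∑ z, lam z * (Q *ᵥ u) z := by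
    rw [mulVec_PGQ_apply hGm]
    refine Finset.sum_congr rfl fun z _ => ?_
    by_cases hz : lam z = 0
    · rw [hz, zero_mul, zero_mul]
    · rw [hQ z hz]
  -- (ii) `u = G^c(A^c u) = G^c(c·Pᵀδ_x) + G^c E`
  have hχP : χ * (Pᵀ *ᵥ Pi.single x 1) = c • (Pᵀ *ᵥ Pi.single x 1) := by
    funext a
    rw [Pi.mul_apply, Pi.smul_apply, smul_eq_mul]
    by_cases ha : (Pᵀ *ᵥ Pi.single x 1) a = 0
    · rw [ha, mul_zero, mul_zero]
    · rw [hP a ha]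
  have h2 : u = Gc *ᵥ (c • (Pᵀ *ᵥ Pi.single x 1)) + Gc *ᵥ E := by
    rw [← Matrix.mulVec_add, ← hχP, hE, add_sub_cancel, Matrix.mulVec_mulVec, hGcAc, Matrix.one_mulVec]
  -- (iii) the first piece is `c·` the dual representation of the comparison operator
  have h3 : ∑ z, lam z * (Q *ᵥ (Gc *ᵥ (c • (Pᵀ *ᵥ Pi.single x 1)))) z = c * ((P * Gc * Qᵀ) *ᵥ lam) x := by
    rw [mulVec_PGQ_apply hGc, Finset.mul_sum]
    refine Finset.sum_congr rfl fun z _ => ?_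
    have hv : Q *ᵥ (Gc *ᵥ (Pᵀ *ᵥ Pi.single x 1)) = Q *ᵥ colW Gc P x := by
      unfold colW
      simp only [Matrix.mulVec_mulVec]
    rw [Matrix.mulVec_smul, Matrix.mulVec_smul, Pi.smul_apply, smul_eq_mul, hv]
    ring
  rw [h1, h2, Matrix.mulVec_add]
  simp only [Pi.add_apply, mul_add, Finset.sum_add_distrib]
  rw [h3, sum_mul_mulVec_mulVec_eq_dot hGc]

/-- the commutator-type vector of the identity is LINEAR in the column once `A·G = 1`: with `E_χ(v) := A^c(χv) − χ·(Av)`,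
`A^c(χw_x) − χ·Pᵀδ_x = E_χ(w_x)`. [cite: Balaban1984PropagatorsI, (1.121) p.37 («K(h)A»), dictionary] -/
theorem commVec_colW {A Gm : Matrix X X ℝ} (hAG : A * Gm = 1) (Ac P : Matrix X X ℝ) (χ : X → ℝ) (x : X) :
    Ac *ᵥ (χ * colW Gm P x) - χ * (Pᵀ *ᵥ Pi.single x 1) = Ac *ᵥ (χ * colW Gm P x) - χ * (A *ᵥ colW Gm P x) := by
  rw [mulVec_colW_of_mul_eq_one hAG]

omit [DecidableEq X] in
/-- `E_χ` is additive∕subtractive in its argument: `E_χ(v) − E_χ(v′) = E_χ(v − v′)`. [cite: Balaban1984PropagatorsI, (1.121) p.37, dictionary (linearity)] -/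
theorem commVec_sub (Ac A : Matrix X X ℝ) (χ v v' : X → ℝ) :
    (Ac *ᵥ (χ * v) - χ * (A *ᵥ v)) - (Ac *ᵥ (χ * v') - χ * (A *ᵥ v')) = Ac *ᵥ (χ * (v - v')) - χ * (A *ᵥ (v - v')) := by
  rw [mul_sub, Matrix.mulVec_sub, Matrix.mulVec_sub, mul_sub]
  abel

end Generic

/-! ## §2 On p21's torus: the commutator pairing bound -/

section Torus

variable {ℓ Mh k R : ℕ} {P : Fin (d + 1) → ℕ} (D : TDomains d ℓ Mh k P R) (a : ℕ → ℝ)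

/-- summation by parts for the FORWARD bond term: `Σ_x φ(x)(χ(x+e_μ) − χ(x))(v(x+e_μ) − v(x)) =
Σ_y v(y)·[φ(y−e_μ)(χ(y) − χ(y−e_μ)) − φ(y)(χ(y+e_μ) − χ(y))]`. [cite: Balaban1984PropagatorsI, (1.121) p.37 (the bond term of K(h)), dictionary] -/
theorem sum_bond_forward_eq (N : Fin (d + 1) → ℕ) (φ χ v : ↥(boxDom N) → ℝ) (μ : Fin (d + 1)) :
    ∑ x, φ x * ((χ (tshift N (unitVec μ) x) - χ x) * (v (tshift N (unitVec μ) x) - v x))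
      = ∑ y, v y * (φ (tshift N (-unitVec μ) y) * (χ y - χ (tshift N (-unitVec μ) y))
          - φ y * (χ (tshift N (unitVec μ) y) - χ y)) := by
  have hsplit : ∀ x, φ x * ((χ (tshift N (unitVec μ) x) - χ x) * (v (tshift N (unitVec μ) x) - v x))
      = φ x * (χ (tshift N (unitVec μ) x) - χ x) * v (tshift N (unitVec μ) x)
        - φ x * (χ (tshift N (unitVec μ) x) - χ x) * v x := fun x => by ring
  simp only [hsplit, Finset.sum_sub_distrib]
  -- reindex the first sum by the translation `x ↦ x + e_μ`
  have hre : ∑ x, φ x * (χ (tshift N (unitVec μ) x) - χ x) * v (tshift N (unitVec μ) x)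
      = ∑ y, φ (tshift N (-unitVec μ) y) * (χ y - χ (tshift N (-unitVec μ) y)) * v y := by
    rw [← Equiv.sum_comp (tshift N (-unitVec μ))]
    refine Finset.sum_congr rfl fun y _ => ?_
    rw [tshift_tshift, neg_add_cancel, tshift_zero]
  rw [hre, ← Finset.sum_sub_distrib]
  exact Finset.sum_congr rfl fun y _ => by ring

/-- summation by parts for the BACKWARD bond term (the forward one for `−e_μ`). [cite: Balaban1984PropagatorsI, (1.121) p.37, dictionary] -/
theorem sum_bond_backward_eq (N : Fin (d + 1) → ℕ) (φ χ v : ↥(boxDom N) → ℝ) (μ : Fin (d + 1)) :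
    ∑ x, φ x * ((χ (tshift N (-unitVec μ) x) - χ x) * (v (tshift N (-unitVec μ) x) - v x))
      = ∑ y, v y * (φ (tshift N (unitVec μ) y) * (χ y - χ (tshift N (unitVec μ) y))
          - φ y * (χ (tshift N (-unitVec μ) y) - χ y)) := by
  have hsplit : ∀ x, φ x * ((χ (tshift N (-unitVec μ) x) - χ x) * (v (tshift N (-unitVec μ) x) - v x))
      = φ x * (χ (tshift N (-unitVec μ) x) - χ x) * v (tshift N (-unitVec μ) x)
        - φ x * (χ (tshift N (-unitVec μ) x) - χ x) * v x := fun x => by ring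
  simp only [hsplit, Finset.sum_sub_distrib]
  have hre : ∑ x, φ x * (χ (tshift N (-unitVec μ) x) - χ x) * v (tshift N (-unitVec μ) x)
      = ∑ y, φ (tshift N (unitVec μ) y) * (χ y - χ (tshift N (unitVec μ) y)) * v y := by
    rw [← Equiv.sum_comp (tshift N (unitVec μ))]
    refine Finset.sum_congr rfl fun y _ => ?_
    rw [tshift_tshift, add_neg_cancel, tshift_zero]
  rw [hre, ← Finset.sum_sub_distrib]
  exact Finset.sum_congr rfl fun y _ => by ring

/-- `levC_j·#B(y) ≤ a_j·L^{−2j}` with the sign of the weights required at levels `≥ 1` only (the blocks have level `≥ 1`; the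
weight at level `0` is repaired to `1`). [cite: Balaban1984PropagatorsII, (2.14) p.225, dictionary] -/
theorem levC_mul_card_le_pos (ha : ∀ j, 1 ≤ j → 0 ≤ a j) (s : ↥(bset D.toDomains)) :
    levC d ℓ a s.1.1 * (((Finset.univ.filter fun x : ↥(boxDom (N0 ℓ Mh k P)) => blkOf D.toDomains x = s).card : ℕ) : ℝ)
      ≤ a s.1.1 * ((((ℓ : ℝ) + 1) ^ s.1.1) ^ 2)⁻¹ := by
  have hj1 : 1 ≤ s.1.1 := (B6Geom246MultiLevelBox.scale_bounds D.toDomains s).1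
  set a' : ℕ → ℝ := fun j => if j = 0 then 1 else a j with ha'
  have ha'0 : ∀ j, 0 ≤ a' j := fun j => by
    rw [ha']; dsimp only; split_ifs with h0
    · exact zero_le_one
    · exact ha j (Nat.pos_of_ne_zero h0)
  have heq : a' s.1.1 = a s.1.1 := by rw [ha']; dsimp only; rw [if_neg (by omega)]
  have hlev : levC d ℓ a s.1.1 = levC d ℓ a' s.1.1 := by unfold levC; rw [heq]
  rw [hlev, ← heq]
  exact levC_mul_card_le D a' ha'0 s

/-- **THE COMMUTATOR DATUM** of a comparison pair on p21's torus around a set `𝒩` of blocks: the cut-off `χ` (values in `[0,1]`,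
first differences `≤ K₁`, pure second differences `≤ K₂`, every site within sup-distance `1` of `supp χ` lies in a block of `𝒩`),
the comparison operator `A^c = −Δ + V^c` on functions supported in `supp χ` with `V^c` an `ℓ¹`-`κ_c`-contraction there, and the
weights of `Δ′_a` dominated by `κ` on `𝒩`. [cite: Balaban1984PropagatorsI, (1.118)–(1.121) p.36–37 (h, Δh = hΔ_a − K(h)); Balaban1984PropagatorsII, (2.13)–(2.14) p.225] -/
structure CommDatum (𝒩 : Finset ↥(bset D.toDomains)) (χ : ↥(boxDom (N0 ℓ Mh k P)) → ℝ)
    (Ac Vc : Matrix ↥(boxDom (N0 ℓ Mh k P)) ↥(boxDom (N0 ℓ Mh k P)) ℝ) (K₁ K₂ κc κ : ℝ) : Prop where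
  χ_nonneg : ∀ y, 0 ≤ χ y
  χ_le_one : ∀ y, χ y ≤ 1
  χ_lip : ∀ μ y, |χ (tshift (N0 ℓ Mh k P) (unitVec μ) y) - χ y| ≤ K₁
  χ_second : ∀ μ y, |2 * χ y - χ (tshift (N0 ℓ Mh k P) (unitVec μ) y) - χ (tshift (N0 ℓ Mh k P) (-unitVec μ) y)| ≤ K₂
  χ_near : ∀ (y : ↥(boxDom (N0 ℓ Mh k P))) (v : Fin (d + 1) → ℤ), (∀ μ, |v μ| ≤ 1) →
    χ (tshift (N0 ℓ Mh k P) v y) ≠ 0 → blkOf D.toDomains y ∈ 𝒩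
  Ac_local : ∀ u : ↥(boxDom (N0 ℓ Mh k P)) → ℝ, (∀ y, χ y = 0 → u y = 0) →
    Ac *ᵥ u = perLapT (N0 ℓ Mh k P) *ᵥ u + Vc *ᵥ u
  Vc_l1 : ∀ u : ↥(boxDom (N0 ℓ Mh k P)) → ℝ, (∀ y, χ y = 0 → u y = 0) → ∑ y, |(Vc *ᵥ u) y| ≤ κc * ∑ y, |u y|
  κc_nonneg : 0 ≤ κc
  κ_nonneg : 0 ≤ κ
  a_nonneg : ∀ j, 1 ≤ j → 0 ≤ a j
  κ_bound : ∀ t ∈ 𝒩, a t.1.1 * ((((ℓ : ℝ) + 1) ^ t.1.1) ^ 2)⁻¹ ≤ κ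

variable {D a}
variable {𝒩 : Finset ↥(bset D.toDomains)} {χ : ↥(boxDom (N0 ℓ Mh k P)) → ℝ}
  {Ac Vc : Matrix ↥(boxDom (N0 ℓ Mh k P)) ↥(boxDom (N0 ℓ Mh k P)) ℝ} {K₁ K₂ κc κ : ℝ}

/-- `|e_μ(κ)| ≤ 1` and `|−e_μ(κ)| ≤ 1` and `|0| ≤ 1` (the translates entering the first and second differences).
[cite: Balaban1983RegularityDecay, p.572, dictionary] -/
theorem abs_unitVec_le_one (μ κ : Fin (d + 1)) :
    |unitVec (d := d) μ κ| ≤ 1 ∧ |(-unitVec (d := d) μ) κ| ≤ 1 ∧ |(0 : Fin (d + 1) → ℤ) κ| ≤ 1 := by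
  simp only [unitVec, Pi.neg_apply, Pi.single_apply, Pi.zero_apply, abs_zero, zero_le_one, and_true]
  split_ifs <;> simp

/-- a site at which `χ`, or a `±e_μ`-translate of `χ`, is non-zero lies in a block of `𝒩`. [cite: Balaban1984PropagatorsI, (1.118) p.36 (supports of h and its differences), dictionary] -/
theorem CommDatum.mem_of_ne (h : CommDatum D a 𝒩 χ Ac Vc K₁ K₂ κc κ) (y : ↥(boxDom (N0 ℓ Mh k P))) (μ : Fin (d + 1))
    (hy : χ y ≠ 0 ∨ χ (tshift (N0 ℓ Mh k P) (unitVec μ) y) ≠ 0 ∨ χ (tshift (N0 ℓ Mh k P) (-unitVec μ) y) ≠ 0) :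
    blkOf D.toDomains y ∈ 𝒩 := by
  rcases hy with h0 | h1 | h2
  · refine h.χ_near y 0 (fun κ => (abs_unitVec_le_one μ κ).2.2) ?_
    rwa [tshift_zero]
  · exact h.χ_near y (unitVec μ) (fun κ => (abs_unitVec_le_one μ κ).1) h1
  · exact h.χ_near y (-unitVec μ) (fun κ => (abs_unitVec_le_one μ κ).2.1) h2

/-- the Laplacian of the cut-off: `|(−Δχ)(y)| ≤ (d+1)K₂`, and it vanishes unless `y` lies in a block of `𝒩`.
[cite: Balaban1984PropagatorsI, (1.118) p.36, dictionary] -/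
theorem CommDatum.perLapT_χ (h : CommDatum D a 𝒩 χ Ac Vc K₁ K₂ κc κ) (y : ↥(boxDom (N0 ℓ Mh k P))) :
    |(perLapT (N0 ℓ Mh k P) *ᵥ χ) y| ≤ ((d : ℝ) + 1) * K₂ ∧
      ((perLapT (N0 ℓ Mh k P) *ᵥ χ) y ≠ 0 → blkOf D.toDomains y ∈ 𝒩) := by
  rw [perLapT_mulVec]
  refine ⟨(Finset.abs_sum_le_sum_abs _ _).trans ?_, fun hne => ?_⟩
  · calc ∑ μ, |2 * χ y - χ (tshift (N0 ℓ Mh k P) (unitVec μ) y) - χ (tshift (N0 ℓ Mh k P) (-unitVec μ) y)|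
        ≤ ∑ _μ : Fin (d + 1), K₂ := Finset.sum_le_sum fun μ _ => h.χ_second μ y
      _ = ((d : ℝ) + 1) * K₂ := by rw [Finset.sum_const, Finset.card_univ, Fintype.card_fin]; simp
  · obtain ⟨μ, -, hμ⟩ := Finset.exists_ne_zero_of_sum_ne_zero hne
    refine h.mem_of_ne y μ ?_
    by_contra hc
    push Not at hc
    obtain ⟨h0, h1, h2⟩ := hc
    exact hμ (by rw [h0, h1, h2]; ring)

/-- ★ **THE COMMUTATOR PAIRING BOUND.**  For a commutator datum around `𝒩` and ANY `φ`, `v`: with `|φ| ≤ Φ₀` everywhere and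
`|∂_μφ|, |∂_μᵀφ| ≤ Φ₁` on the blocks of `𝒩`,
`|⟨φ, A^c(χv) − χ·Δ′_a v⟩| ≤ [Φ₀(3(d+1)K₂ + κ_c + κ) + 2(d+1)K₁Φ₁]·Σ_{t∈𝒩}Σ_{y∈B(t)}|v(y)|`.
The four pieces: `⟨φ, v·(−Δχ)⟩` (`≤ Φ₀(d+1)K₂`), the bond term `⟨φ, B(χ,v)⟩` after summation by parts (`≤ 2(d+1)(Φ₁K₁ + Φ₀K₂)`),
`⟨φ, V^c(χv)⟩` (`≤ Φ₀κ_c`), `⟨φ, χ·(Δ′_a − (−Δ))v⟩` (`≤ Φ₀κ`, block by block with `levC_j·#B ≤ a_jL^{−2j}`).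
[cite: Balaban1984PropagatorsI, (1.121) p.37 («Δh A = hΔ_aA − K(h)A»), (1.128) p.38 (the bound of hK(h)); Balaban1984PropagatorsII, (2.13)–(2.14) p.225; Balaban1985BackgroundPropagators, (3.44) p.398] -/
theorem pairing_commutator_le (h : CommDatum D a 𝒩 χ Ac Vc K₁ K₂ κc κ) (φ v : ↥(boxDom (N0 ℓ Mh k P)) → ℝ) {Φ₀ Φ₁ : ℝ}
    (hΦ₀0 : 0 ≤ Φ₀) (hΦ₀ : ∀ y, |φ y| ≤ Φ₀) (hΦ₁0 : 0 ≤ Φ₁)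
    (hΦ₁ : ∀ μ y, blkOf D.toDomains y ∈ 𝒩 →
      |(dT (N0 ℓ Mh k P) μ *ᵥ φ) y| ≤ Φ₁ ∧ |((dT (N0 ℓ Mh k P) μ)ᵀ *ᵥ φ) y| ≤ Φ₁) :
    |φ ⬝ᵥ (Ac *ᵥ (χ * v) - χ * (mlOpT (N0 ℓ Mh k P) ℓ k D.lev a *ᵥ v))|
      ≤ (Φ₀ * (3 * ((d : ℝ) + 1) * K₂ + κc + κ) + 2 * ((d : ℝ) + 1) * K₁ * Φ₁)
          * ∑ t ∈ 𝒩, ∑ y ∈ Finset.univ.filter (fun y => blkOf D.toDomains y = t), |v y| := by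
  classical
  set W : ℝ := ∑ t ∈ 𝒩, ∑ y ∈ Finset.univ.filter (fun y => blkOf D.toDomains y = t), |v y| with hW
  have hW0 : 0 ≤ W := Finset.sum_nonneg fun _ _ => Finset.sum_nonneg fun _ _ => abs_nonneg _
  -- signs available from any site
  have hK₁0 : ∀ y : ↥(boxDom (N0 ℓ Mh k P)), 0 ≤ K₁ := fun y => (abs_nonneg _).trans (h.χ_lip 0 y)
  have hK₂0 : ∀ y : ↥(boxDom (N0 ℓ Mh k P)), 0 ≤ K₂ := fun y => (abs_nonneg _).trans (h.χ_second 0 y)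
  -- (0) the commutator vector, pointwise: Laplacian of `χ`, bond term, `V^c`, block averaging
  have hχv : ∀ y, χ y = 0 → (χ * v) y = 0 := fun y hy => by rw [Pi.mul_apply, hy, zero_mul]
  set Bnd : ↥(boxDom (N0 ℓ Mh k P)) → ℝ := fun y => ∑ μ, ((χ (tshift (N0 ℓ Mh k P) (unitVec μ) y) - χ y) * (v (tshift (N0 ℓ Mh k P) (unitVec μ) y) - v y)
      + (χ (tshift (N0 ℓ Mh k P) (-unitVec μ) y) - χ y) * (v (tshift (N0 ℓ Mh k P) (-unitVec μ) y) - v y)) with hBnd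
  set Sblk : ↥(boxDom (N0 ℓ Mh k P)) → ℝ := fun y =>
      levC d ℓ a (D.lev y.1) * ∑ z ∈ Finset.univ.filter (fun z => blkOf D.toDomains z = blkOf D.toDomains y), v z with hSblk
  have hE : ∀ y, (Ac *ᵥ (χ * v) - χ * (mlOpT (N0 ℓ Mh k P) ℓ k D.lev a *ᵥ v)) y
      = v y * (perLapT (N0 ℓ Mh k P) *ᵥ χ) y - Bnd y + (Vc *ᵥ (χ * v)) y - χ y * Sblk y := by
    intro y
    rw [Pi.sub_apply, h.Ac_local _ hχv, Pi.add_apply, Pi.mul_apply, mlOpT_mulVec_eq D a v y,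
      show (χ * v) = (fun z => χ z * v z) from rfl, perLapT_mulVec_mul (N0 ℓ Mh k P) χ v y]
    simp only [hBnd, hSblk]
    ring
  have hsplit : φ ⬝ᵥ (Ac *ᵥ (χ * v) - χ * (mlOpT (N0 ℓ Mh k P) ℓ k D.lev a *ᵥ v))
      = (∑ y, φ y * (v y * (perLapT (N0 ℓ Mh k P) *ᵥ χ) y)) - (∑ y, φ y * Bnd y) + (∑ y, φ y * (Vc *ᵥ (χ * v)) y)
        - ∑ y, φ y * (χ y * Sblk y) := by
    simp only [dotProduct, hE, mul_add, mul_sub, Finset.sum_add_distrib, Finset.sum_sub_distrib]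
  -- (1) the Laplacian-of-`χ` term
  have hT1 : |∑ y, φ y * (v y * (perLapT (N0 ℓ Mh k P) *ᵥ χ) y)| ≤ Φ₀ * (((d : ℝ) + 1) * K₂) * W := by
    calc |∑ y, φ y * (v y * (perLapT (N0 ℓ Mh k P) *ᵥ χ) y)| ≤ ∑ y, |φ y * (v y * (perLapT (N0 ℓ Mh k P) *ᵥ χ) y)| := Finset.abs_sum_le_sum_abs _ _
      _ = ∑ y, (|φ y| * |(perLapT (N0 ℓ Mh k P) *ᵥ χ) y|) * |v y| := Finset.sum_congr rfl fun y _ => by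
          rw [abs_mul, abs_mul]; ring
      _ ≤ Φ₀ * (((d : ℝ) + 1) * K₂) * W := by
          refine sum_weight_le D _ _ 𝒩 (fun y => ?_) (fun y => abs_nonneg _) (fun y hy => ?_)
          · exact mul_le_mul (hΦ₀ y) (h.perLapT_χ y).1 (abs_nonneg _) hΦ₀0
          · exact (h.perLapT_χ y).2 fun h0 => hy (by rw [h0, abs_zero, mul_zero])
  -- (2) the bond term, summed by parts direction by direction
  have hT2 : |∑ y, φ y * Bnd y| ≤ 2 * ((d : ℝ) + 1) * (Φ₁ * K₁ + Φ₀ * K₂) * W := by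
    have hswap : ∑ y, φ y * Bnd y
        = ∑ μ, ((∑ y, φ y * ((χ (tshift (N0 ℓ Mh k P) (unitVec μ) y) - χ y) * (v (tshift (N0 ℓ Mh k P) (unitVec μ) y) - v y)))
          + ∑ y, φ y * ((χ (tshift (N0 ℓ Mh k P) (-unitVec μ) y) - χ y) * (v (tshift (N0 ℓ Mh k P) (-unitVec μ) y) - v y))) := by
      simp only [hBnd, Finset.mul_sum, mul_add]
      rw [Finset.sum_comm]
      simp only [Finset.sum_add_distrib]
    rw [hswap]
    refine (Finset.abs_sum_le_sum_abs _ _).trans ?_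
    have hμ : ∀ μ : Fin (d + 1),
        |(∑ y, φ y * ((χ (tshift (N0 ℓ Mh k P) (unitVec μ) y) - χ y) * (v (tshift (N0 ℓ Mh k P) (unitVec μ) y) - v y)))
          + ∑ y, φ y * ((χ (tshift (N0 ℓ Mh k P) (-unitVec μ) y) - χ y) * (v (tshift (N0 ℓ Mh k P) (-unitVec μ) y) - v y))|
          ≤ 2 * (Φ₁ * K₁ + Φ₀ * K₂) * W := by
      intro μ
      rw [sum_bond_forward_eq, sum_bond_backward_eq]
      -- the forward piece
      have hF : |∑ y, v y * (φ (tshift (N0 ℓ Mh k P) (-unitVec μ) y) * (χ y - χ (tshift (N0 ℓ Mh k P) (-unitVec μ) y))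
          - φ y * (χ (tshift (N0 ℓ Mh k P) (unitVec μ) y) - χ y))| ≤ (Φ₁ * K₁ + Φ₀ * K₂) * W := by
        refine (Finset.abs_sum_le_sum_abs _ _).trans ?_
        have hre : ∀ y, |v y * (φ (tshift (N0 ℓ Mh k P) (-unitVec μ) y) * (χ y - χ (tshift (N0 ℓ Mh k P) (-unitVec μ) y))
            - φ y * (χ (tshift (N0 ℓ Mh k P) (unitVec μ) y) - χ y))|
            = |φ (tshift (N0 ℓ Mh k P) (-unitVec μ) y) * (χ y - χ (tshift (N0 ℓ Mh k P) (-unitVec μ) y))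
                - φ y * (χ (tshift (N0 ℓ Mh k P) (unitVec μ) y) - χ y)| * |v y| := fun y => by rw [abs_mul, mul_comm]
        simp only [hre]
        refine sum_weight_le D _ _ 𝒩 (fun y => ?_) (fun y => abs_nonneg _) (fun y hy => ?_)
        · -- `= (φ(y−e) − φ(y))(χ(y) − χ(y−e)) + φ(y)(2χ(y) − χ(y+e) − χ(y−e))`
          have e : φ (tshift (N0 ℓ Mh k P) (-unitVec μ) y) * (χ y - χ (tshift (N0 ℓ Mh k P) (-unitVec μ) y))
              - φ y * (χ (tshift (N0 ℓ Mh k P) (unitVec μ) y) - χ y)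
              = ((dT (N0 ℓ Mh k P) μ)ᵀ *ᵥ φ) y * (χ y - χ (tshift (N0 ℓ Mh k P) (-unitVec μ) y))
                + φ y * (2 * χ y - χ (tshift (N0 ℓ Mh k P) (unitVec μ) y) - χ (tshift (N0 ℓ Mh k P) (-unitVec μ) y)) := by
            rw [dT_transpose_mulVec]; ring
          rw [e]
          by_cases hmem : blkOf D.toDomains y ∈ 𝒩
          · have h1 := (hΦ₁ μ y hmem).2
            have h2 : |χ y - χ (tshift (N0 ℓ Mh k P) (-unitVec μ) y)| ≤ K₁ := by
              have := h.χ_lip μ (tshift (N0 ℓ Mh k P) (-unitVec μ) y)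
              rwa [tshift_tshift, neg_add_cancel, tshift_zero] at this
            have h3 := h.χ_second μ y
            have h4 := hΦ₀ y
            calc _ ≤ |((dT (N0 ℓ Mh k P) μ)ᵀ *ᵥ φ) y * (χ y - χ (tshift (N0 ℓ Mh k P) (-unitVec μ) y))|
                  + |φ y * (2 * χ y - χ (tshift (N0 ℓ Mh k P) (unitVec μ) y) - χ (tshift (N0 ℓ Mh k P) (-unitVec μ) y))| := abs_add_le _ _
              _ ≤ Φ₁ * K₁ + Φ₀ * K₂ := by
                  rw [abs_mul, abs_mul]
                  exact add_le_add (mul_le_mul h1 h2 (abs_nonneg _) hΦ₁0) (mul_le_mul h4 h3 (abs_nonneg _) hΦ₀0)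
          · -- off `𝒩`: `χ` vanishes at `y` and its two translates, so the weight is `0`
            have h0 : χ y = 0 := by by_contra hc; exact hmem (h.mem_of_ne y μ (Or.inl hc))
            have h1 : χ (tshift (N0 ℓ Mh k P) (unitVec μ) y) = 0 := by by_contra hc; exact hmem (h.mem_of_ne y μ (Or.inr (Or.inl hc)))
            have h2 : χ (tshift (N0 ℓ Mh k P) (-unitVec μ) y) = 0 := by by_contra hc; exact hmem (h.mem_of_ne y μ (Or.inr (Or.inr hc)))
            rw [h0, h1, h2]
            simp only [sub_zero, mul_zero, add_zero, abs_zero]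
            have := hK₁0 y; have := hK₂0 y
            positivity
        · -- a non-zero weight forces a non-zero `χ` nearby
          refine h.mem_of_ne y μ ?_
          by_contra hc
          push Not at hc
          obtain ⟨h0, h1, h2⟩ := hc
          exact hy (by rw [h0, h1, h2]; simp)
      -- the backward piece
      have hB : |∑ y, v y * (φ (tshift (N0 ℓ Mh k P) (unitVec μ) y) * (χ y - χ (tshift (N0 ℓ Mh k P) (unitVec μ) y))
          - φ y * (χ (tshift (N0 ℓ Mh k P) (-unitVec μ) y) - χ y))| ≤ (Φ₁ * K₁ + Φ₀ * K₂) * W := by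
        refine (Finset.abs_sum_le_sum_abs _ _).trans ?_
        have hre : ∀ y, |v y * (φ (tshift (N0 ℓ Mh k P) (unitVec μ) y) * (χ y - χ (tshift (N0 ℓ Mh k P) (unitVec μ) y))
            - φ y * (χ (tshift (N0 ℓ Mh k P) (-unitVec μ) y) - χ y))|
            = |φ (tshift (N0 ℓ Mh k P) (unitVec μ) y) * (χ y - χ (tshift (N0 ℓ Mh k P) (unitVec μ) y))
                - φ y * (χ (tshift (N0 ℓ Mh k P) (-unitVec μ) y) - χ y)| * |v y| := fun y => by rw [abs_mul, mul_comm]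
        simp only [hre]
        refine sum_weight_le D _ _ 𝒩 (fun y => ?_) (fun y => abs_nonneg _) (fun y hy => ?_)
        · have e : φ (tshift (N0 ℓ Mh k P) (unitVec μ) y) * (χ y - χ (tshift (N0 ℓ Mh k P) (unitVec μ) y))
              - φ y * (χ (tshift (N0 ℓ Mh k P) (-unitVec μ) y) - χ y)
              = (dT (N0 ℓ Mh k P) μ *ᵥ φ) y * (χ y - χ (tshift (N0 ℓ Mh k P) (unitVec μ) y))
                + φ y * (2 * χ y - χ (tshift (N0 ℓ Mh k P) (unitVec μ) y) - χ (tshift (N0 ℓ Mh k P) (-unitVec μ) y)) := by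
            rw [dT_mulVec]; ring
          rw [e]
          by_cases hmem : blkOf D.toDomains y ∈ 𝒩
          · have h1 := (hΦ₁ μ y hmem).1
            have h2 : |χ y - χ (tshift (N0 ℓ Mh k P) (unitVec μ) y)| ≤ K₁ := by
              rw [abs_sub_comm]; exact h.χ_lip μ y
            have h3 := h.χ_second μ y
            have h4 := hΦ₀ y
            calc _ ≤ |(dT (N0 ℓ Mh k P) μ *ᵥ φ) y * (χ y - χ (tshift (N0 ℓ Mh k P) (unitVec μ) y))|
                  + |φ y * (2 * χ y - χ (tshift (N0 ℓ Mh k P) (unitVec μ) y) - χ (tshift (N0 ℓ Mh k P) (-unitVec μ) y))| := abs_add_le _ _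
              _ ≤ Φ₁ * K₁ + Φ₀ * K₂ := by
                  rw [abs_mul, abs_mul]
                  exact add_le_add (mul_le_mul h1 h2 (abs_nonneg _) hΦ₁0) (mul_le_mul h4 h3 (abs_nonneg _) hΦ₀0)
          · have h0 : χ y = 0 := by by_contra hc; exact hmem (h.mem_of_ne y μ (Or.inl hc))
            have h1 : χ (tshift (N0 ℓ Mh k P) (unitVec μ) y) = 0 := by by_contra hc; exact hmem (h.mem_of_ne y μ (Or.inr (Or.inl hc)))
            have h2 : χ (tshift (N0 ℓ Mh k P) (-unitVec μ) y) = 0 := by by_contra hc; exact hmem (h.mem_of_ne y μ (Or.inr (Or.inr hc)))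
            rw [h0, h1, h2]
            simp only [sub_zero, mul_zero, add_zero, abs_zero]
            have := hK₁0 y; have := hK₂0 y
            positivity
        · refine h.mem_of_ne y μ ?_
          by_contra hc
          push Not at hc
          obtain ⟨h0, h1, h2⟩ := hc
          exact hy (by rw [h0, h1, h2]; simp)
      calc _ ≤ |∑ y, v y * (φ (tshift (N0 ℓ Mh k P) (-unitVec μ) y) * (χ y - χ (tshift (N0 ℓ Mh k P) (-unitVec μ) y))
                - φ y * (χ (tshift (N0 ℓ Mh k P) (unitVec μ) y) - χ y))|
            + |∑ y, v y * (φ (tshift (N0 ℓ Mh k P) (unitVec μ) y) * (χ y - χ (tshift (N0 ℓ Mh k P) (unitVec μ) y))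
                - φ y * (χ (tshift (N0 ℓ Mh k P) (-unitVec μ) y) - χ y))| := abs_add_le _ _
        _ ≤ (Φ₁ * K₁ + Φ₀ * K₂) * W + (Φ₁ * K₁ + Φ₀ * K₂) * W := add_le_add hF hB
        _ = 2 * (Φ₁ * K₁ + Φ₀ * K₂) * W := by ring
    calc ∑ μ, |(∑ y, φ y * ((χ (tshift (N0 ℓ Mh k P) (unitVec μ) y) - χ y) * (v (tshift (N0 ℓ Mh k P) (unitVec μ) y) - v y)))
          + ∑ y, φ y * ((χ (tshift (N0 ℓ Mh k P) (-unitVec μ) y) - χ y) * (v (tshift (N0 ℓ Mh k P) (-unitVec μ) y) - v y))|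
        ≤ ∑ _μ : Fin (d + 1), 2 * (Φ₁ * K₁ + Φ₀ * K₂) * W := Finset.sum_le_sum fun μ _ => hμ μ
      _ = 2 * ((d : ℝ) + 1) * (Φ₁ * K₁ + Φ₀ * K₂) * W := by
          rw [Finset.sum_const, Finset.card_univ, Fintype.card_fin]; simp; ring
  -- (3) the comparison averaging `V^c`
  have hT3 : |∑ y, φ y * (Vc *ᵥ (χ * v)) y| ≤ Φ₀ * κc * W := by
    have hl1 := h.Vc_l1 (χ * v) hχv
    have hχv1 : ∑ y, |(χ * v) y| ≤ W := by
      have e : ∀ y, |(χ * v) y| = |χ y| * |v y| := fun y => by rw [Pi.mul_apply, abs_mul]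
      simp only [e]
      have := sum_weight_le D (fun y => |χ y|) (fun y => |v y|) 𝒩 (Wc := 1)
        (fun y => by rw [abs_of_nonneg (h.χ_nonneg y)]; exact h.χ_le_one y) (fun y => abs_nonneg _)
        (fun y hy => h.mem_of_ne y 0 (Or.inl fun h0 => hy (by rw [h0, abs_zero])))
      rwa [one_mul] at this
    calc |∑ y, φ y * (Vc *ᵥ (χ * v)) y| ≤ ∑ y, |φ y * (Vc *ᵥ (χ * v)) y| := Finset.abs_sum_le_sum_abs _ _
      _ ≤ ∑ y, Φ₀ * |(Vc *ᵥ (χ * v)) y| := Finset.sum_le_sum fun y _ => by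
          rw [abs_mul]; exact mul_le_mul_of_nonneg_right (hΦ₀ y) (abs_nonneg _)
      _ = Φ₀ * ∑ y, |(Vc *ᵥ (χ * v)) y| := by rw [Finset.mul_sum]
      _ ≤ Φ₀ * (κc * W) := mul_le_mul_of_nonneg_left (hl1.trans (mul_le_mul_of_nonneg_left hχv1 h.κc_nonneg)) hΦ₀0
      _ = Φ₀ * κc * W := by ring
  -- (4) the block averagings of `Δ′_a`
  have hT4 : |∑ y, φ y * (χ y * Sblk y)| ≤ Φ₀ * κ * W := by
    calc |∑ y, φ y * (χ y * Sblk y)| ≤ ∑ y, |φ y * (χ y * Sblk y)| := Finset.abs_sum_le_sum_abs _ _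
      _ = ∑ y, |χ y| * (|φ y| * |Sblk y|) := Finset.sum_congr rfl fun y _ => by rw [abs_mul, abs_mul]; ring
      _ ≤ 1 * ∑ t ∈ 𝒩, ∑ y ∈ Finset.univ.filter (fun y => blkOf D.toDomains y = t), |φ y| * |Sblk y| :=
          sum_weight_le D (fun y => |χ y|) (fun y => |φ y| * |Sblk y|) 𝒩
            (fun y => by rw [abs_of_nonneg (h.χ_nonneg y)]; exact h.χ_le_one y) (fun y => by positivity)
            (fun y hy => h.mem_of_ne y 0 (Or.inl fun h0 => hy (by rw [h0, abs_zero])))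
      _ = ∑ t ∈ 𝒩, ∑ y ∈ Finset.univ.filter (fun y => blkOf D.toDomains y = t), |φ y| * |Sblk y| := one_mul _
      _ ≤ ∑ t ∈ 𝒩, Φ₀ * κ * ∑ y ∈ Finset.univ.filter (fun y => blkOf D.toDomains y = t), |v y| := by
          refine Finset.sum_le_sum fun t ht => ?_
          set Bt := Finset.univ.filter (fun y : ↥(boxDom (N0 ℓ Mh k P)) => blkOf D.toDomains y = t) with hBt
          -- on `B(t)`: `Sblk y = levC_t · Σ_{B(t)} v`
          have hS : ∀ y ∈ Bt, Sblk y = levC d ℓ a t.1.1 * ∑ z ∈ Bt, v z := by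
            intro y hy
            have hyt : blkOf D.toDomains y = t := (Finset.mem_filter.1 hy).2
            simp only [hSblk]
            rw [lev_eq_scale D y, hyt]
          have hj1 : 1 ≤ t.1.1 := (B6Geom246MultiLevelBox.scale_bounds D.toDomains t).1
          have hat : 0 ≤ a t.1.1 := h.a_nonneg t.1.1 hj1
          have hc0 : 0 ≤ levC d ℓ a t.1.1 := by unfold levC; positivity
          have hκt : levC d ℓ a t.1.1 * ((Bt.card : ℕ) : ℝ) ≤ κ :=
            (levC_mul_card_le_pos D a h.a_nonneg t).trans (h.κ_bound t ht)
          have hv0 : 0 ≤ ∑ z ∈ Bt, |v z| := Finset.sum_nonneg fun _ _ => abs_nonneg _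
          calc ∑ y ∈ Bt, |φ y| * |Sblk y| ≤ ∑ y ∈ Bt, Φ₀ * (levC d ℓ a t.1.1 * ∑ z ∈ Bt, |v z|) := by
                refine Finset.sum_le_sum fun y hy => ?_
                rw [hS y hy, abs_mul, abs_of_nonneg hc0]
                exact mul_le_mul (hΦ₀ y) (mul_le_mul_of_nonneg_left (Finset.abs_sum_le_sum_abs _ _) hc0)
                  (by positivity) hΦ₀0
            _ = Φ₀ * (levC d ℓ a t.1.1 * ((Bt.card : ℕ) : ℝ)) * ∑ z ∈ Bt, |v z| := by
                rw [Finset.sum_const, nsmul_eq_mul]; ring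
            _ ≤ Φ₀ * κ * ∑ z ∈ Bt, |v z| := mul_le_mul_of_nonneg_right (mul_le_mul_of_nonneg_left hκt hΦ₀0) hv0
      _ = Φ₀ * κ * W := by rw [hW, Finset.mul_sum]
  -- assemble
  rw [hsplit]
  set X1 : ℝ := ∑ y, φ y * (v y * (perLapT (N0 ℓ Mh k P) *ᵥ χ) y) with hX1
  set X2 : ℝ := ∑ y, φ y * Bnd y with hX2
  set X3 : ℝ := ∑ y, φ y * (Vc *ᵥ (χ * v)) y with hX3
  set X4 : ℝ := ∑ y, φ y * (χ y * Sblk y) with hX4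
  have e1 : |X1 - X2 + X3 - X4| ≤ |X1 - X2 + X3| + |X4| := abs_sub _ _
  have e2 : |X1 - X2 + X3| ≤ |X1 - X2| + |X3| := abs_add_le _ _
  have e3 : |X1 - X2| ≤ |X1| + |X2| := abs_sub _ _
  calc |X1 - X2 + X3 - X4| ≤ |X1| + |X2| + |X3| + |X4| := by linarith
    _ ≤ Φ₀ * (((d : ℝ) + 1) * K₂) * W + 2 * ((d : ℝ) + 1) * (Φ₁ * K₁ + Φ₀ * K₂) * W + Φ₀ * κc * W + Φ₀ * κ * W := by
          linarith [hT1, hT2, hT3, hT4]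
    _ = (Φ₀ * (3 * ((d : ℝ) + 1) * K₂ + κc + κ) + 2 * ((d : ℝ) + 1) * K₁ * Φ₁) * W := by ring

end Torus

/-! ## §3 Row-block `ℓ¹` norms from majorants: the column `w_x = G′∂_μᵀδ_x` through p21's members 1 and 4 -/

section RowBlock

variable {ℓ Mh k R : ℕ} {P : Fin (d + 1) → ℕ} (D : TDomains d ℓ Mh k P R)

omit D in
/-- distinct sites of the torus are at torus sup-distance `≥ 1`. [cite: Balaban1983RegularityDecay, p.572 («a torus T_η … with periodic conditions»), dictionary] -/
theorem one_le_torusSupNorm_of_ne {N : Fin (d + 1) → ℕ} {x x' : ↥(boxDom N)} (h : x'.1 ≠ x.1) :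
    1 ≤ torusSupNorm N (x'.1 - x.1) := by
  obtain ⟨j, hj⟩ : ∃ j, x'.1 j ≠ x.1 j := by
    by_contra hc
    push Not at hc
    exact h (funext hc)
  have hN : 1 ≤ N j := one_le_of_mem x.2 j
  have hx := (B4Reflection242.mem_boxDom.1 x.2) j
  have hx' := (B4Reflection242.mem_boxDom.1 x'.2) j
  set v : ℤ := x'.1 j - x.1 j with hv
  have hv0 : v ≠ 0 := sub_ne_zero.2 hj
  have hvN : v.natAbs < (N j : ℤ).natAbs := by
    have h1 : |v| < (N j : ℤ) := by rw [abs_lt]; constructor <;> omega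
    have h2 : (v.natAbs : ℤ) < ((N j : ℤ).natAbs : ℤ) := by
      rw [Int.natCast_natAbs, Int.natCast_natAbs, abs_of_nonneg (by positivity : (0 : ℤ) ≤ (N j : ℤ))]
      exact h1
    exact_mod_cast h2
  have hr0 : v % (N j : ℤ) ≠ 0 := fun h0 =>
    hv0 (Int.eq_zero_of_dvd_of_natAbs_lt_natAbs (Int.dvd_of_emod_eq_zero h0) hvN)
  have hNpos : (0 : ℤ) < (N j : ℤ) := by exact_mod_cast hN
  have hr1 := Int.emod_nonneg v hNpos.ne'
  have hr2 := Int.emod_lt_of_pos v hNpos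
  have hc : 1 ≤ B4TorusKernel.MultiPeriod.circAbs (N j) v := by
    unfold B4TorusKernel.MultiPeriod.circAbs
    refine le_min ?_ ?_ <;> omega
  have hcr : (1 : ℝ) ≤ ((B4TorusKernel.MultiPeriod.circAbs (N j) ((x'.1 - x.1) j) : ℤ) : ℝ) := by
    rw [Pi.sub_apply, ← hv]; exact_mod_cast hc
  unfold torusSupNorm
  exact hcr.trans (Finset.le_sup' (fun i => ((B4TorusKernel.MultiPeriod.circAbs (N i) ((x'.1 - x.1) i) : ℤ) : ℝ))
    (Finset.mem_univ j))

/-- **THE COLUMN IS THE ROW**: `w_x(z) = (G′∂_μᵀδ_x)(z) = (∂_μG′)(x, z)` for p21's symmetric `G′ = gmlT`.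
[cite: Balaban1984PropagatorsII, p.225 («a well defined, positive operator»), dictionary] -/
theorem colW_gmlT_apply (a : ℕ → ℝ) (μ : Fin (d + 1)) (x z : ↥(boxDom (N0 ℓ Mh k P))) :
    colW (gmlT (N0 ℓ Mh k P) ℓ k D.lev a) (dT (N0 ℓ Mh k P) μ) x z
      = (dT (N0 ℓ Mh k P) μ * gmlT (N0 ℓ Mh k P) ℓ k D.lev a) x z :=
  colW_apply_of_isSymm gmlT_isSymm _ x z

/-- ★ **ROW-BLOCK `ℓ¹` OF THE COLUMN FROM p21's MEMBER 1 of (2.67)** (`prop22_second_multiLevelTorus`): under p21's hypotheses there are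
`δ₀, C, M₀ > 0`, `N₀ ≥ 1` with `Σ_{z∈B(t)} |w_x(z)| ≤ C·L^{j(x)}·e^{−½δ₀d_T(y(x), t)}` for every admissible torus family, every
`μ`, every site `x` and every block `t`. [cite: Balaban1984PropagatorsII, Prop. 2.2 (2.67) p.234 (second entry), (2.64)–(2.66) p.234] -/
theorem rowBlock_l1_dGp (d ℓ : ℕ) (hℓ : 1 ≤ ℓ) (aminus aplus a2minus a2plus : ℝ) (ha : 0 < aminus) (ha2 : 0 < a2minus) :
    ∃ δ₀ C M₀ : ℝ, ∃ N₀ : ℕ, 0 < δ₀ ∧ 0 < C ∧ 0 < M₀ ∧ 0 < N₀ ∧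
      ∀ (k Mh R : ℕ), 3 ≤ Mh → M₀ ≤ ((ℓ : ℝ) + 1) * Mh → 2 * (ℓ + 1) ≤ R → N₀ + 1 ≤ R * ((ℓ + 1) * Mh) →
      ∀ (P : Fin (d + 1) → ℕ) (hP : ∀ μ, 1 ≤ P μ) (hP4 : ∀ μ, 4 ≤ P μ) (D : TDomains d ℓ Mh k P R) (a c : ℕ → ℝ),
        (∀ i, 1 ≤ i → aminus ≤ a i ∧ a i ≤ aplus) → (∀ i, 1 ≤ i → a2minus ≤ c i ∧ c i ≤ a2plus) →
        (∀ i, 1 ≤ i → a (i + 1) = aNext ℓ (a i) (c i)) → ∀ (μ : Fin (d + 1)) (x : ↥(boxDom (N0 ℓ Mh k P)))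
        (t : ↥(bset D.toDomains)),
        ∑ z ∈ Finset.univ.filter (fun z => blkOf D.toDomains z = t), |colW (gmlT (N0 ℓ Mh k P) ℓ k D.lev a) (dT (N0 ℓ Mh k P) μ) x z|
          ≤ C * ((ℓ : ℝ) + 1) ^ (blkOf D.toDomains x).1.1 * Real.exp (-(δ₀ / 2 * (geomT D).dist (blkOf D.toDomains x) t)) := by
  obtain ⟨δ₀, C, M₀, N₀, hδ₀, hC, hM₀, hN₀, H⟩ := prop22_second_multiLevelTorus d ℓ hℓ aminus aplus a2minus a2plus ha ha2
  refine ⟨δ₀, C, M₀, N₀, hδ₀, hC, hM₀, hN₀, ?_⟩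
  intro k Mh R hMh hM hR hRM P hP hP4 D a c haw hcw hac μ x t
  have hmaj := H k Mh R hMh hM hR hRM P hP hP4 D a c haw hcw hac μ
  have h := B9Ineq346GpFlatMultiLevelTorus.row_abs_sum_le D hmaj x t
  simp only [colW_gmlT_apply]
  exact h

/-- ★ **ROW-BLOCK `ℓ¹` OF THE DIFFERENCE OF TWO COLUMNS OF ONE BLOCK FROM p21's MEMBER 4 of (2.67)** (`prop22_fourth_multiLevelTorus_unif`):
`δ₀, M₀, N₀` uniform in `α`, `C = C(α)`, and for `x ≠ x′` of one block of level `j`: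
`Σ_{z∈B(t)} |w_{x′}(z) − w_x(z)| ≤ C·|x′−x|_T^α·(L^j)^{1−α}·e^{−½δ₀d_T(y(x), t)}`.
[cite: Balaban1984PropagatorsII, Prop. 2.2 (2.67) p.234 (fourth entry); Balaban1983RegularityDecay, Theorem (1.9) p.573] -/
theorem rowBlock_l1_dGp_holder (d ℓ : ℕ) (hℓ : 1 ≤ ℓ) (aminus aplus a2minus a2plus : ℝ) (ha : 0 < aminus)
    (ha2 : 0 < a2minus) :
    ∃ δ₀ M₀ : ℝ, ∃ N₀ : ℕ, 0 < δ₀ ∧ 0 < M₀ ∧ 0 < N₀ ∧ ∀ (α : ℝ), 0 ≤ α → α < 1 → ∃ C : ℝ, 0 < C ∧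
      ∀ (k Mh R : ℕ), 3 ≤ Mh → M₀ ≤ ((ℓ : ℝ) + 1) * Mh → 2 * (ℓ + 1) ≤ R → N₀ + 1 ≤ R * ((ℓ + 1) * Mh) →
      ∀ (P : Fin (d + 1) → ℕ) (hP : ∀ μ, 1 ≤ P μ) (hP4 : ∀ μ, 4 ≤ P μ) (D : TDomains d ℓ Mh k P R) (a c : ℕ → ℝ),
        (∀ i, 1 ≤ i → aminus ≤ a i ∧ a i ≤ aplus) → (∀ i, 1 ≤ i → a2minus ≤ c i ∧ c i ≤ a2plus) →
        (∀ i, 1 ≤ i → a (i + 1) = aNext ℓ (a i) (c i)) →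
        ∀ (μ : Fin (d + 1)) (x x' : ↥(boxDom (N0 ℓ Mh k P))), x'.1 ≠ x.1 → blkOf D.toDomains x' = blkOf D.toDomains x →
        ∀ t : ↥(bset D.toDomains),
        ∑ z ∈ Finset.univ.filter (fun z => blkOf D.toDomains z = t),
            |colW (gmlT (N0 ℓ Mh k P) ℓ k D.lev a) (dT (N0 ℓ Mh k P) μ) x' z
              - colW (gmlT (N0 ℓ Mh k P) ℓ k D.lev a) (dT (N0 ℓ Mh k P) μ) x z|
          ≤ C * (torusSupNorm (N0 ℓ Mh k P) (x'.1 - x.1)) ^ α * (((ℓ : ℝ) + 1) ^ D.lev x.1) ^ (1 - α)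
              * Real.exp (-(δ₀ / 2 * (geomT D).dist (blkOf D.toDomains x) t)) := by
  classical
  obtain ⟨δ₀, M₀, N₀, hδ₀, hM₀, hN₀, H⟩ := prop22_fourth_multiLevelTorus_unif d ℓ hℓ aminus aplus a2minus a2plus ha ha2
  refine ⟨δ₀, M₀, N₀, hδ₀, hM₀, hN₀, fun α hα0 hα1 => ?_⟩
  obtain ⟨C, hC, HC⟩ := H α hα0 hα1
  refine ⟨C, hC, ?_⟩
  intro k Mh R hMh hM hR hRM P hP hP4 D a c haw hcw hac μ x x' hne hblk t
  set M := dT (N0 ℓ Mh k P) μ * gmlT (N0 ℓ Mh k P) ℓ k D.lev a with hMdef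
  -- the sign pattern of the difference of the two rows on the block
  set sg : ↥(boxDom (N0 ℓ Mh k P)) → ℝ := fun z =>
    if blkOf D.toDomains z = t then (if 0 ≤ M x' z - M x z then 1 else -1) else 0 with hsg
  have hbs : BlockSupp (g := geomT D) (blkOf D.toDomains) sg t 1 := by
    refine ⟨zero_le_one, fun z hz => ?_, fun z hz => ?_⟩
    · simp only [hsg, hz, if_true]; split_ifs <;> simp
    · simp only [hsg]
      split_ifs with h1
      · exact absurd h1 hz
      · exact absurd h1 hz
      · rfl
  have hmain := HC k Mh R hMh hM hR hRM P hP hP4 D a c haw hcw hac μ t sg 1 hbs x x' hne hblk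
  -- the differences of `G′sg` are the entries of `M = ∂_μG′` tested against `sg`
  have hrow : ∀ y : ↥(boxDom (N0 ℓ Mh k P)), (gmlT (N0 ℓ Mh k P) ℓ k D.lev a *ᵥ sg) (tshift (N0 ℓ Mh k P) (unitVec μ) y) - (gmlT (N0 ℓ Mh k P) ℓ k D.lev a *ᵥ sg) y
      = (M *ᵥ sg) y := fun y => by rw [hMdef, ← Matrix.mulVec_mulVec, dT_mulVec]
  rw [hrow x', hrow x, mul_one] at hmain
  have hsum : (M *ᵥ sg) x' - (M *ᵥ sg) x
      = ∑ z ∈ Finset.univ.filter (fun z => blkOf D.toDomains z = t), |M x' z - M x z| := by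
    simp only [Matrix.mulVec, dotProduct, hsg]
    rw [← Finset.sum_sub_distrib, Finset.sum_filter]
    refine Finset.sum_congr rfl fun z _ => ?_
    split_ifs with h1 h2
    · rw [mul_one, mul_one, abs_of_nonneg h2]
    · rw [mul_neg, mul_one, mul_neg, mul_one, abs_of_neg (lt_of_not_ge h2)]; ring
    · rw [mul_zero, mul_zero, sub_zero]
  rw [hsum] at hmain
  have hS0 : 0 ≤ ∑ z ∈ Finset.univ.filter (fun z => blkOf D.toDomains z = t), |M x' z - M x z| :=
    Finset.sum_nonneg fun _ _ => abs_nonneg _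
  rw [abs_of_nonneg hS0] at hmain
  -- multiply through by `|x′−x|_T^α > 0`
  have htpos : 0 < torusSupNorm (N0 ℓ Mh k P) (x'.1 - x.1) := lt_of_lt_of_le one_pos (one_le_torusSupNorm_of_ne hne)
  have htα : 0 < torusSupNorm (N0 ℓ Mh k P) (x'.1 - x.1) ^ (-α) := Real.rpow_pos_of_pos htpos _
  have hcol : ∀ z, colW (gmlT (N0 ℓ Mh k P) ℓ k D.lev a) (dT (N0 ℓ Mh k P) μ) x' z - colW (gmlT (N0 ℓ Mh k P) ℓ k D.lev a) (dT (N0 ℓ Mh k P) μ) x z = M x' z - M x z := by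
    intro z; rw [colW_gmlT_apply, colW_gmlT_apply]
  simp only [hcol]
  have key : ∑ z ∈ Finset.univ.filter (fun z => blkOf D.toDomains z = t), |M x' z - M x z|
      ≤ (torusSupNorm (N0 ℓ Mh k P) (x'.1 - x.1)) ^ α * (C * (((ℓ : ℝ) + 1) ^ D.lev x.1) ^ (1 - α)
          * Real.exp (-(δ₀ / 2 * (geomT D).dist (blkOf D.toDomains x) t))) := by
    rw [← div_le_iff₀' (Real.rpow_pos_of_pos htpos α), div_eq_mul_inv, ← Real.rpow_neg htpos.le, mul_comm]
    exact hmain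
  refine key.trans (le_of_eq ?_)
  ring

end RowBlock

/-! ## §4 The assembled reductions for `Ψ = ∂_μG′∂_νᵀλ`: (3.44)- and (3.45)-shapes -/

section Assembly

variable {ℓ Mh k R : ℕ} {P : Fin (d + 1) → ℕ} (D : TDomains d ℓ Mh k P R) {a : ℕ → ℝ}
variable {𝒩 : Finset ↥(bset D.toDomains)} {χ : ↥(boxDom (N0 ℓ Mh k P)) → ℝ}
  {Ac Gc Vc : Matrix ↥(boxDom (N0 ℓ Mh k P)) ↥(boxDom (N0 ℓ Mh k P)) ℝ} {K₁ K₂ κc κ : ℝ}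

omit D in
/-- the `∂_ν`-stencil of `supp λ` lies in the plateau of `χ` ⇒ `∂_νw` and `∂_ν(χw)` agree on `supp λ`.
[cite: Balaban1985BackgroundPropagators, (3.44) p.398 («supp λ ⊂ Δ̃(y′)»), dictionary] -/
theorem dT_mulVec_mul_eq_of_plateau (ν : Fin (d + 1)) (lam χ' w : ↥(boxDom (N0 ℓ Mh k P)) → ℝ)
    (hpl : ∀ z, lam z ≠ 0 → χ' z = 1 ∧ χ' (tshift (N0 ℓ Mh k P) (unitVec ν) z) = 1) :
    ∀ z, lam z ≠ 0 → (dT (N0 ℓ Mh k P) ν *ᵥ w) z = (dT (N0 ℓ Mh k P) ν *ᵥ (χ' * w)) z := by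
  intro z hz
  obtain ⟨h0, h1⟩ := hpl z hz
  rw [dT_mulVec, dT_mulVec, Pi.mul_apply, Pi.mul_apply, h0, h1, one_mul, one_mul]

omit D in
/-- the support of `∂_μᵀδ_x` is `{x, x + e_μ}`. [cite: Balaban1984PropagatorsII, (2.67) p.234 (the forward difference), dictionary] -/
theorem eq_or_eq_shift_of_dT_transpose_single_ne (μ : Fin (d + 1)) (x y : ↥(boxDom (N0 ℓ Mh k P)))
    (hy : ((dT (N0 ℓ Mh k P) μ)ᵀ *ᵥ Pi.single x 1) y ≠ 0) : y = x ∨ y = tshift (N0 ℓ Mh k P) (unitVec μ) x := by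
  classical
  rw [dT_transpose_mulVec] at hy
  by_cases h1 : y = x
  · exact Or.inl h1
  · right
    have h2 : (Pi.single x (1 : ℝ) : ↥(boxDom (N0 ℓ Mh k P)) → ℝ) y = 0 := Pi.single_eq_of_ne h1 _
    rw [h2, sub_zero] at hy
    have h3 : tshift (N0 ℓ Mh k P) (-unitVec μ) y = x := by
      by_contra hc
      exact hy (Pi.single_eq_of_ne hc _)
    have h4 := congrArg (tshift (N0 ℓ Mh k P) (unitVec μ)) h3
    rwa [tshift_tshift, neg_add_cancel, tshift_zero] at h4

/-- `Δ′_a·G′ = 1` with positivity of the weights at levels `≥ 1` only (the weight at level `0` is never used).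
[cite: Balaban1984PropagatorsII, p.225 («G′ = Δ′_a^{−1}»)] -/
theorem mlOpT_mul_gmlT_pos (hMh : 1 ≤ Mh) (hP : ∀ μ, 1 ≤ P μ) (ha : ∀ j, 1 ≤ j → 0 < a j) :
    mlOpT (N0 ℓ Mh k P) ℓ k D.lev a * gmlT (N0 ℓ Mh k P) ℓ k D.lev a = 1 := by
  set a' : ℕ → ℝ := fun j => if j = 0 then 1 else a j with ha'
  have hpos : ∀ j, 0 < a' j := fun j => by
    rw [ha']; dsimp only; split_ifs with h0
    · exact one_pos
    · exact ha j (Nat.pos_of_ne_zero h0)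
  have hcongr : mlOpT (N0 ℓ Mh k P) ℓ k D.lev a = mlOpT (N0 ℓ Mh k P) ℓ k D.lev a' :=
    B6Prop22MultiLevelTorus.mlOpT_congr_weights (N := N0 ℓ Mh k P) (ℓ := ℓ) (k := k) D.one_le_lev
      (fun j hj => by rw [ha']; dsimp only; rw [if_neg (by omega)])
  have hG : gmlT (N0 ℓ Mh k P) ℓ k D.lev a = gmlT (N0 ℓ Mh k P) ℓ k D.lev a' := by unfold gmlT; rw [hcongr]
  rw [hcongr, hG]
  exact mlOpT_mul_gmlT (one_le_N0 hMh hP) D.lev_le hpos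

/-- ★★ **THE (3.44)-SHAPE REDUCTION**: for a comparison pair `G^cA^c = 1` (`G^c` symmetric) with a commutator datum around `𝒩`, a `λ`
whose `∂_ν`-stencil lies in the plateau of `χ`, and a site `x` with `χ(x) = χ(x+e_μ) = c`:
`|(∂_μG′∂_νᵀλ)(x)| ≤ |c|·|(∂_μG^c∂_νᵀλ)(x)| + Θ·Σ_{t∈𝒩}Σ_{z∈B(t)}|w_x(z)|`,
`Θ = Φ₀(3(d+1)K₂ + κ_c + κ) + 2(d+1)K₁Φ₁`, where `Φ₀` bounds `|G^c∂_νᵀλ|` and `Φ₁` its first differences on the blocks of `𝒩` (the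
LOCAL (1.110)₃ and (1.112)-type data of the comparison operator). [cite: Balaban1985BackgroundPropagators, Thm 3.1 (3.44) p.398 + Cor. 3.5 p.407; Balaban1984PropagatorsI, Prop. 1.2 (1.110), (1.112) p.36, (1.121)–(1.131) pp.37–38] -/
theorem abs_dGpd_le_dual (hMh : 1 ≤ Mh) (hP : ∀ μ, 1 ≤ P μ) (ha : ∀ j, 1 ≤ j → 0 < a j)
    (hGc : Gc.IsSymm) (hGcAc : Gc * Ac = 1) (h : CommDatum D a 𝒩 χ Ac Vc K₁ K₂ κc κ)
    (μ ν : Fin (d + 1)) (lam : ↥(boxDom (N0 ℓ Mh k P)) → ℝ) (x : ↥(boxDom (N0 ℓ Mh k P))) (c : ℝ)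
    (hpl : ∀ z, lam z ≠ 0 → χ z = 1 ∧ χ (tshift (N0 ℓ Mh k P) (unitVec ν) z) = 1)
    (hx : χ x = c ∧ χ (tshift (N0 ℓ Mh k P) (unitVec μ) x) = c)
    {Φ₀ Φ₁ : ℝ} (hΦ₀0 : 0 ≤ Φ₀) (hΦ₀ : ∀ y, |((Gc * (dT (N0 ℓ Mh k P) ν)ᵀ) *ᵥ lam) y| ≤ Φ₀) (hΦ₁0 : 0 ≤ Φ₁)
    (hΦ₁ : ∀ κ' y, blkOf D.toDomains y ∈ 𝒩 →
      |(dT (N0 ℓ Mh k P) κ' *ᵥ ((Gc * (dT (N0 ℓ Mh k P) ν)ᵀ) *ᵥ lam)) y| ≤ Φ₁ ∧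
      |((dT (N0 ℓ Mh k P) κ')ᵀ *ᵥ ((Gc * (dT (N0 ℓ Mh k P) ν)ᵀ) *ᵥ lam)) y| ≤ Φ₁) :
    |((dT (N0 ℓ Mh k P) μ * gmlT (N0 ℓ Mh k P) ℓ k D.lev a * (dT (N0 ℓ Mh k P) ν)ᵀ) *ᵥ lam) x|
      ≤ |c| * |((dT (N0 ℓ Mh k P) μ * Gc * (dT (N0 ℓ Mh k P) ν)ᵀ) *ᵥ lam) x|
        + (Φ₀ * (3 * ((d : ℝ) + 1) * K₂ + κc + κ) + 2 * ((d : ℝ) + 1) * K₁ * Φ₁)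
          * ∑ t ∈ 𝒩, ∑ z ∈ Finset.univ.filter (fun z => blkOf D.toDomains z = t),
              |colW (gmlT (N0 ℓ Mh k P) ℓ k D.lev a) (dT (N0 ℓ Mh k P) μ) x z| := by
  have hid := dual_comparison_identity (Gm := gmlT (N0 ℓ Mh k P) ℓ k D.lev a) gmlT_isSymm hGc hGcAc (dT (N0 ℓ Mh k P) μ) (dT (N0 ℓ Mh k P) ν) lam χ x c
    (dT_mulVec_mul_eq_of_plateau ν lam χ _ hpl)
    (fun y hy => by
      rcases eq_or_eq_shift_of_dT_transpose_single_ne μ x y hy with h1 | h1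
      · rw [h1]; exact hx.1
      · rw [h1]; exact hx.2)
  rw [hid, commVec_colW (mlOpT_mul_gmlT_pos D hMh hP ha) Ac (dT (N0 ℓ Mh k P) μ) χ x]
  have hpair := pairing_commutator_le h ((Gc * (dT (N0 ℓ Mh k P) ν)ᵀ) *ᵥ lam)
    (colW (gmlT (N0 ℓ Mh k P) ℓ k D.lev a) (dT (N0 ℓ Mh k P) μ) x) hΦ₀0 hΦ₀ hΦ₁0 hΦ₁
  calc _ ≤ |c * ((dT (N0 ℓ Mh k P) μ * Gc * (dT (N0 ℓ Mh k P) ν)ᵀ) *ᵥ lam) x|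
        + |((Gc * (dT (N0 ℓ Mh k P) ν)ᵀ) *ᵥ lam) ⬝ᵥ
            (Ac *ᵥ (χ * colW (gmlT (N0 ℓ Mh k P) ℓ k D.lev a) (dT (N0 ℓ Mh k P) μ) x)
              - χ * (mlOpT (N0 ℓ Mh k P) ℓ k D.lev a *ᵥ colW (gmlT (N0 ℓ Mh k P) ℓ k D.lev a) (dT (N0 ℓ Mh k P) μ) x))| :=
        abs_add_le _ _
    _ ≤ _ := by rw [abs_mul]; exact add_le_add le_rfl hpair

/-- ★★ **THE (3.45)-SHAPE REDUCTION**: the SAME `χ`, `c` for two sites `x, x′` (both `χ(·) = χ(· + e_μ) = c`):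
`|(∂_μG′∂_νᵀλ)(x′) − (∂_μG′∂_νᵀλ)(x)| ≤ |c|·|(∂_μG^c∂_νᵀλ)(x′) − (∂_μG^c∂_νᵀλ)(x)| + Θ·Σ_{t∈𝒩}Σ_{z∈B(t)}|w_{x′}(z) − w_x(z)|`
(the commutator vector is linear in the column). [cite: Balaban1985BackgroundPropagators, Thm 3.1 (3.45) p.398 + Cor. 3.5 p.407; Balaban1984PropagatorsI, Prop. 1.2 (1.113) p.36, (1.121)–(1.131) pp.37–38] -/
theorem abs_dGpd_sub_le_dual (hMh : 1 ≤ Mh) (hP : ∀ μ, 1 ≤ P μ) (ha : ∀ j, 1 ≤ j → 0 < a j)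
    (hGc : Gc.IsSymm) (hGcAc : Gc * Ac = 1) (h : CommDatum D a 𝒩 χ Ac Vc K₁ K₂ κc κ)
    (μ ν : Fin (d + 1)) (lam : ↥(boxDom (N0 ℓ Mh k P)) → ℝ) (x x' : ↥(boxDom (N0 ℓ Mh k P))) (c : ℝ)
    (hpl : ∀ z, lam z ≠ 0 → χ z = 1 ∧ χ (tshift (N0 ℓ Mh k P) (unitVec ν) z) = 1)
    (hx : χ x = c ∧ χ (tshift (N0 ℓ Mh k P) (unitVec μ) x) = c)
    (hx' : χ x' = c ∧ χ (tshift (N0 ℓ Mh k P) (unitVec μ) x') = c)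
    {Φ₀ Φ₁ : ℝ} (hΦ₀0 : 0 ≤ Φ₀) (hΦ₀ : ∀ y, |((Gc * (dT (N0 ℓ Mh k P) ν)ᵀ) *ᵥ lam) y| ≤ Φ₀) (hΦ₁0 : 0 ≤ Φ₁)
    (hΦ₁ : ∀ κ' y, blkOf D.toDomains y ∈ 𝒩 →
      |(dT (N0 ℓ Mh k P) κ' *ᵥ ((Gc * (dT (N0 ℓ Mh k P) ν)ᵀ) *ᵥ lam)) y| ≤ Φ₁ ∧
      |((dT (N0 ℓ Mh k P) κ')ᵀ *ᵥ ((Gc * (dT (N0 ℓ Mh k P) ν)ᵀ) *ᵥ lam)) y| ≤ Φ₁) :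
    |((dT (N0 ℓ Mh k P) μ * gmlT (N0 ℓ Mh k P) ℓ k D.lev a * (dT (N0 ℓ Mh k P) ν)ᵀ) *ᵥ lam) x'
        - ((dT (N0 ℓ Mh k P) μ * gmlT (N0 ℓ Mh k P) ℓ k D.lev a * (dT (N0 ℓ Mh k P) ν)ᵀ) *ᵥ lam) x|
      ≤ |c| * |((dT (N0 ℓ Mh k P) μ * Gc * (dT (N0 ℓ Mh k P) ν)ᵀ) *ᵥ lam) x'
            - ((dT (N0 ℓ Mh k P) μ * Gc * (dT (N0 ℓ Mh k P) ν)ᵀ) *ᵥ lam) x|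
        + (Φ₀ * (3 * ((d : ℝ) + 1) * K₂ + κc + κ) + 2 * ((d : ℝ) + 1) * K₁ * Φ₁)
          * ∑ t ∈ 𝒩, ∑ z ∈ Finset.univ.filter (fun z => blkOf D.toDomains z = t),
              |colW (gmlT (N0 ℓ Mh k P) ℓ k D.lev a) (dT (N0 ℓ Mh k P) μ) x' z
                - colW (gmlT (N0 ℓ Mh k P) ℓ k D.lev a) (dT (N0 ℓ Mh k P) μ) x z| := by
  have hAG := mlOpT_mul_gmlT_pos D hMh hP ha
  have hid := dual_comparison_identity (Gm := gmlT (N0 ℓ Mh k P) ℓ k D.lev a) gmlT_isSymm hGc hGcAc (dT (N0 ℓ Mh k P) μ) (dT (N0 ℓ Mh k P) ν) lam χ x c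
    (dT_mulVec_mul_eq_of_plateau ν lam χ _ hpl)
    (fun y hy => by
      rcases eq_or_eq_shift_of_dT_transpose_single_ne μ x y hy with h1 | h1
      · rw [h1]; exact hx.1
      · rw [h1]; exact hx.2)
  have hid' := dual_comparison_identity (Gm := gmlT (N0 ℓ Mh k P) ℓ k D.lev a) gmlT_isSymm hGc hGcAc (dT (N0 ℓ Mh k P) μ) (dT (N0 ℓ Mh k P) ν) lam χ x' c
    (dT_mulVec_mul_eq_of_plateau ν lam χ _ hpl)
    (fun y hy => by
      rcases eq_or_eq_shift_of_dT_transpose_single_ne μ x' y hy with h1 | h1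
      · rw [h1]; exact hx'.1
      · rw [h1]; exact hx'.2)
  rw [hid, hid', commVec_colW hAG Ac (dT (N0 ℓ Mh k P) μ) χ x, commVec_colW hAG Ac (dT (N0 ℓ Mh k P) μ) χ x']
  set φ := (Gc * (dT (N0 ℓ Mh k P) ν)ᵀ) *ᵥ lam with hφ
  set w := colW (gmlT (N0 ℓ Mh k P) ℓ k D.lev a) (dT (N0 ℓ Mh k P) μ) x with hw
  set w' := colW (gmlT (N0 ℓ Mh k P) ℓ k D.lev a) (dT (N0 ℓ Mh k P) μ) x' with hw'
  set A := mlOpT (N0 ℓ Mh k P) ℓ k D.lev a with hA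
  have hdiff : c * ((dT (N0 ℓ Mh k P) μ * Gc * (dT (N0 ℓ Mh k P) ν)ᵀ) *ᵥ lam) x' + φ ⬝ᵥ (Ac *ᵥ (χ * w') - χ * (A *ᵥ w'))
      - (c * ((dT (N0 ℓ Mh k P) μ * Gc * (dT (N0 ℓ Mh k P) ν)ᵀ) *ᵥ lam) x + φ ⬝ᵥ (Ac *ᵥ (χ * w) - χ * (A *ᵥ w)))
      = c * (((dT (N0 ℓ Mh k P) μ * Gc * (dT (N0 ℓ Mh k P) ν)ᵀ) *ᵥ lam) x'
          - ((dT (N0 ℓ Mh k P) μ * Gc * (dT (N0 ℓ Mh k P) ν)ᵀ) *ᵥ lam) x)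
        + φ ⬝ᵥ (Ac *ᵥ (χ * (w' - w)) - χ * (A *ᵥ (w' - w))) := by
    have key : ∀ (T T' : ℝ) (E E' : ↥(boxDom (N0 ℓ Mh k P)) → ℝ),
        c * T' + φ ⬝ᵥ E' - (c * T + φ ⬝ᵥ E) = c * (T' - T) + φ ⬝ᵥ (E' - E) := by
      intro T T' E E'
      rw [dotProduct_sub]; ring
    rw [key, commVec_sub]
  rw [hdiff]
  have hpair := pairing_commutator_le h φ (w' - w) hΦ₀0 hΦ₀ hΦ₁0 hΦ₁
  have hsum : ∑ t ∈ 𝒩, ∑ z ∈ Finset.univ.filter (fun z => blkOf D.toDomains z = t), |(w' - w) z|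
      = ∑ t ∈ 𝒩, ∑ z ∈ Finset.univ.filter (fun z => blkOf D.toDomains z = t), |w' z - w z| := by
    simp only [Pi.sub_apply]
  rw [hsum] at hpair
  calc _ ≤ |c * (((dT (N0 ℓ Mh k P) μ * Gc * (dT (N0 ℓ Mh k P) ν)ᵀ) *ᵥ lam) x'
            - ((dT (N0 ℓ Mh k P) μ * Gc * (dT (N0 ℓ Mh k P) ν)ᵀ) *ᵥ lam) x)|
        + |φ ⬝ᵥ (Ac *ᵥ (χ * (w' - w)) - χ * (A *ᵥ (w' - w)))| := abs_add_le _ _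
    _ ≤ _ := by rw [abs_mul]; exact add_le_add le_rfl hpair

/-- ★★ **THE (3.44)-SHAPE REDUCTION WITH p21's MEMBER 1**: for every admissible torus family of lit-balaban-p21's programme
(`M_h ≥ 3`, `L·M_h ≥ M₀`, `R ≥ 2L`, `RM ≥ N₀ + 1`, `P_μ ≥ 4`, weights in the windows with the recursion), every comparison pair with a
commutator datum around `𝒩`, every `λ` in the plateau and every `x` with `χ(x) = χ(x+e_μ) = c`:
`|(∂_μG′∂_νᵀλ)(x)| ≤ |c|·|(∂_μG^c∂_νᵀλ)(x)| + Θ·Σ_{t∈𝒩} C·L^{j(x)}·e^{−½δ₀d_T(y(x), t)}`.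
[cite: Balaban1985BackgroundPropagators, Thm 3.1 (3.44) p.398 + Cor. 3.5 p.407; Balaban1984PropagatorsII, Prop. 2.2 (2.67) p.234; Balaban1984PropagatorsI, Prop. 1.2 (1.112) p.36] -/
theorem abs_dGpd_le_dual_majorant (d ℓ : ℕ) (hℓ : 1 ≤ ℓ) (aminus aplus a2minus a2plus : ℝ) (ha : 0 < aminus)
    (ha2 : 0 < a2minus) :
    ∃ δ₀ C M₀ : ℝ, ∃ N₀ : ℕ, 0 < δ₀ ∧ 0 < C ∧ 0 < M₀ ∧ 0 < N₀ ∧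
      ∀ (k Mh R : ℕ), 3 ≤ Mh → M₀ ≤ ((ℓ : ℝ) + 1) * Mh → 2 * (ℓ + 1) ≤ R → N₀ + 1 ≤ R * ((ℓ + 1) * Mh) →
      ∀ (P : Fin (d + 1) → ℕ) (hP : ∀ μ, 1 ≤ P μ) (hP4 : ∀ μ, 4 ≤ P μ) (D : TDomains d ℓ Mh k P R) (a c : ℕ → ℝ),
        (∀ i, 1 ≤ i → aminus ≤ a i ∧ a i ≤ aplus) → (∀ i, 1 ≤ i → a2minus ≤ c i ∧ c i ≤ a2plus) →
        (∀ i, 1 ≤ i → a (i + 1) = aNext ℓ (a i) (c i)) →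
      ∀ (𝒩 : Finset ↥(bset D.toDomains)) (χ : ↥(boxDom (N0 ℓ Mh k P)) → ℝ)
        (Ac Gc Vc : Matrix ↥(boxDom (N0 ℓ Mh k P)) ↥(boxDom (N0 ℓ Mh k P)) ℝ) (K₁ K₂ κc κ : ℝ),
        Gc.IsSymm → Gc * Ac = 1 → CommDatum D a 𝒩 χ Ac Vc K₁ K₂ κc κ →
      ∀ (μ ν : Fin (d + 1)) (lam : ↥(boxDom (N0 ℓ Mh k P)) → ℝ) (x : ↥(boxDom (N0 ℓ Mh k P))) (cc : ℝ),
        (∀ z, lam z ≠ 0 → χ z = 1 ∧ χ (tshift (N0 ℓ Mh k P) (unitVec ν) z) = 1) →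
        (χ x = cc ∧ χ (tshift (N0 ℓ Mh k P) (unitVec μ) x) = cc) →
      ∀ (Φ₀ Φ₁ : ℝ), 0 ≤ Φ₀ → (∀ y, |((Gc * (dT (N0 ℓ Mh k P) ν)ᵀ) *ᵥ lam) y| ≤ Φ₀) → 0 ≤ Φ₁ →
        (∀ κ' y, blkOf D.toDomains y ∈ 𝒩 →
          |(dT (N0 ℓ Mh k P) κ' *ᵥ ((Gc * (dT (N0 ℓ Mh k P) ν)ᵀ) *ᵥ lam)) y| ≤ Φ₁ ∧
          |((dT (N0 ℓ Mh k P) κ')ᵀ *ᵥ ((Gc * (dT (N0 ℓ Mh k P) ν)ᵀ) *ᵥ lam)) y| ≤ Φ₁) →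
        |((dT (N0 ℓ Mh k P) μ * gmlT (N0 ℓ Mh k P) ℓ k D.lev a * (dT (N0 ℓ Mh k P) ν)ᵀ) *ᵥ lam) x|
          ≤ |cc| * |((dT (N0 ℓ Mh k P) μ * Gc * (dT (N0 ℓ Mh k P) ν)ᵀ) *ᵥ lam) x|
            + (Φ₀ * (3 * ((d : ℝ) + 1) * K₂ + κc + κ) + 2 * ((d : ℝ) + 1) * K₁ * Φ₁)
              * ∑ t ∈ 𝒩, C * ((ℓ : ℝ) + 1) ^ (blkOf D.toDomains x).1.1
                  * Real.exp (-(δ₀ / 2 * (geomT D).dist (blkOf D.toDomains x) t)) := by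
  obtain ⟨δ₀, C, M₀, N₀, hδ₀, hC, hM₀, hN₀, H⟩ := rowBlock_l1_dGp d ℓ hℓ aminus aplus a2minus a2plus ha ha2
  refine ⟨δ₀, C, M₀, N₀, hδ₀, hC, hM₀, hN₀, ?_⟩
  intro k Mh R hMh hM hR hRM P hP hP4 D a c haw hcw hac 𝒩 χ Ac Gc Vc K₁ K₂ κc κ hGc hGcAc h μ ν lam x cc hpl hx
    Φ₀ Φ₁ hΦ₀0 hΦ₀ hΦ₁0 hΦ₁
  have hMh1 : 1 ≤ Mh := le_trans (by norm_num) hMh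
  have hapos : ∀ j, 1 ≤ j → 0 < a j := fun j hj => ha.trans_le (haw j hj).1
  have h1 := abs_dGpd_le_dual D hMh1 hP hapos hGc hGcAc h μ ν lam x cc hpl hx hΦ₀0 hΦ₀ hΦ₁0 hΦ₁
  refine h1.trans (add_le_add le_rfl (mul_le_mul_of_nonneg_left (Finset.sum_le_sum fun t _ =>
    H k Mh R hMh hM hR hRM P hP hP4 D a c haw hcw hac μ x t) ?_))
  -- `Θ ≥ 0`
  have hK₁0 : 0 ≤ K₁ := (abs_nonneg _).trans (h.χ_lip 0 x)
  have hK₂0 : 0 ≤ K₂ := (abs_nonneg _).trans (h.χ_second 0 x)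
  have hκc := h.κc_nonneg
  have hκ0 := h.κ_nonneg
  positivity

/-- ★★ **THE (3.45)-SHAPE REDUCTION WITH p21's MEMBER 4**: `δ₀, M₀, N₀` uniform in `α ∈ [0,1)`, `C = C(α)`; for every admissible torus
family, comparison pair with a commutator datum, `λ` in the plateau, and `x ≠ x′` of ONE block with `χ(·) = χ(· + e_μ) = c` at both:
`|Ψ(x′) − Ψ(x)| ≤ |c|·|(∂_μG^c∂_νᵀλ)(x′) − (∂_μG^c∂_νᵀλ)(x)| + Θ·Σ_{t∈𝒩} C·|x′−x|_T^α·(L^{j})^{1−α}·e^{−½δ₀d_T(y(x), t)}`.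
[cite: Balaban1985BackgroundPropagators, Thm 3.1 (3.45) p.398 + Cor. 3.5 p.407; Balaban1984PropagatorsII, Prop. 2.2 (2.67) p.234 (fourth entry); Balaban1984PropagatorsI, Prop. 1.2 (1.113) p.36] -/
theorem abs_dGpd_sub_le_dual_majorant (d ℓ : ℕ) (hℓ : 1 ≤ ℓ) (aminus aplus a2minus a2plus : ℝ) (ha : 0 < aminus)
    (ha2 : 0 < a2minus) :
    ∃ δ₀ M₀ : ℝ, ∃ N₀ : ℕ, 0 < δ₀ ∧ 0 < M₀ ∧ 0 < N₀ ∧ ∀ (α : ℝ), 0 ≤ α → α < 1 → ∃ C : ℝ, 0 < C ∧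
      ∀ (k Mh R : ℕ), 3 ≤ Mh → M₀ ≤ ((ℓ : ℝ) + 1) * Mh → 2 * (ℓ + 1) ≤ R → N₀ + 1 ≤ R * ((ℓ + 1) * Mh) →
      ∀ (P : Fin (d + 1) → ℕ) (hP : ∀ μ, 1 ≤ P μ) (hP4 : ∀ μ, 4 ≤ P μ) (D : TDomains d ℓ Mh k P R) (a c : ℕ → ℝ),
        (∀ i, 1 ≤ i → aminus ≤ a i ∧ a i ≤ aplus) → (∀ i, 1 ≤ i → a2minus ≤ c i ∧ c i ≤ a2plus) →
        (∀ i, 1 ≤ i → a (i + 1) = aNext ℓ (a i) (c i)) →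
      ∀ (𝒩 : Finset ↥(bset D.toDomains)) (χ : ↥(boxDom (N0 ℓ Mh k P)) → ℝ)
        (Ac Gc Vc : Matrix ↥(boxDom (N0 ℓ Mh k P)) ↥(boxDom (N0 ℓ Mh k P)) ℝ) (K₁ K₂ κc κ : ℝ),
        Gc.IsSymm → Gc * Ac = 1 → CommDatum D a 𝒩 χ Ac Vc K₁ K₂ κc κ →
      ∀ (μ ν : Fin (d + 1)) (lam : ↥(boxDom (N0 ℓ Mh k P)) → ℝ) (x x' : ↥(boxDom (N0 ℓ Mh k P))) (cc : ℝ),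
        x'.1 ≠ x.1 → blkOf D.toDomains x' = blkOf D.toDomains x →
        (∀ z, lam z ≠ 0 → χ z = 1 ∧ χ (tshift (N0 ℓ Mh k P) (unitVec ν) z) = 1) →
        (χ x = cc ∧ χ (tshift (N0 ℓ Mh k P) (unitVec μ) x) = cc) →
        (χ x' = cc ∧ χ (tshift (N0 ℓ Mh k P) (unitVec μ) x') = cc) →
      ∀ (Φ₀ Φ₁ : ℝ), 0 ≤ Φ₀ → (∀ y, |((Gc * (dT (N0 ℓ Mh k P) ν)ᵀ) *ᵥ lam) y| ≤ Φ₀) → 0 ≤ Φ₁ →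
        (∀ κ' y, blkOf D.toDomains y ∈ 𝒩 →
          |(dT (N0 ℓ Mh k P) κ' *ᵥ ((Gc * (dT (N0 ℓ Mh k P) ν)ᵀ) *ᵥ lam)) y| ≤ Φ₁ ∧
          |((dT (N0 ℓ Mh k P) κ')ᵀ *ᵥ ((Gc * (dT (N0 ℓ Mh k P) ν)ᵀ) *ᵥ lam)) y| ≤ Φ₁) →
        |((dT (N0 ℓ Mh k P) μ * gmlT (N0 ℓ Mh k P) ℓ k D.lev a * (dT (N0 ℓ Mh k P) ν)ᵀ) *ᵥ lam) x'
            - ((dT (N0 ℓ Mh k P) μ * gmlT (N0 ℓ Mh k P) ℓ k D.lev a * (dT (N0 ℓ Mh k P) ν)ᵀ) *ᵥ lam) x|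
          ≤ |cc| * |((dT (N0 ℓ Mh k P) μ * Gc * (dT (N0 ℓ Mh k P) ν)ᵀ) *ᵥ lam) x'
                - ((dT (N0 ℓ Mh k P) μ * Gc * (dT (N0 ℓ Mh k P) ν)ᵀ) *ᵥ lam) x|
            + (Φ₀ * (3 * ((d : ℝ) + 1) * K₂ + κc + κ) + 2 * ((d : ℝ) + 1) * K₁ * Φ₁)
              * ∑ t ∈ 𝒩, C * (torusSupNorm (N0 ℓ Mh k P) (x'.1 - x.1)) ^ α * (((ℓ : ℝ) + 1) ^ D.lev x.1) ^ (1 - α)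
                  * Real.exp (-(δ₀ / 2 * (geomT D).dist (blkOf D.toDomains x) t)) := by
  obtain ⟨δ₀, M₀, N₀, hδ₀, hM₀, hN₀, H⟩ := rowBlock_l1_dGp_holder d ℓ hℓ aminus aplus a2minus a2plus ha ha2
  refine ⟨δ₀, M₀, N₀, hδ₀, hM₀, hN₀, fun α hα0 hα1 => ?_⟩
  obtain ⟨C, hC, HC⟩ := H α hα0 hα1
  refine ⟨C, hC, ?_⟩
  intro k Mh R hMh hM hR hRM P hP hP4 D a c haw hcw hac 𝒩 χ Ac Gc Vc K₁ K₂ κc κ hGc hGcAc h μ ν lam x x' cc hne hblk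
    hpl hx hx' Φ₀ Φ₁ hΦ₀0 hΦ₀ hΦ₁0 hΦ₁
  have hMh1 : 1 ≤ Mh := le_trans (by norm_num) hMh
  have hapos : ∀ j, 1 ≤ j → 0 < a j := fun j hj => ha.trans_le (haw j hj).1
  have h1 := abs_dGpd_sub_le_dual D hMh1 hP hapos hGc hGcAc h μ ν lam x x' cc hpl hx hx' hΦ₀0 hΦ₀ hΦ₁0 hΦ₁
  refine h1.trans (add_le_add le_rfl (mul_le_mul_of_nonneg_left (Finset.sum_le_sum fun t _ =>
    HC k Mh R hMh hM hR hRM P hP hP4 D a c haw hcw hac μ x x' hne hblk t) ?_))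
  have hK₁0 : 0 ≤ K₁ := (abs_nonneg _).trans (h.χ_lip 0 x)
  have hK₂0 : 0 ≤ K₂ := (abs_nonneg _).trans (h.χ_second 0 x)
  have hκc := h.κc_nonneg
  have hκ0 := h.κ_nonneg
  positivity

end Assembly

end Literature.MathematicalPhysics.QuantumFieldTheory.Balaban1983to89.B9Ineq344DualComparisonTorus

end
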